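import Literature.Topology.FourManifolds.CorkDecompositionAssembly
import Literature.Topology.FourManifolds.OrientedConnectedSumExistence
import Literature.Topology.FourManifolds.SmoothEmbeddingComp
import Literature.Topology.FourManifolds.ChartTransport
import HarnessLib

/-!
# Matveyev's fig. 2 (the splitting identity) from seam-adapted gluing witnesses

This file proves the named fact `Literature.Topology.FourManifolds.exists_isConnectedSum_isBoundaryGluing_of_halfDiscs`
(`CorkDecompositionSplitting.lean`, the "splitting rung" `(S)` of the DAG below the cork theorem
`Literature.Topology.FourManifolds.corkDecomposition`; Matveyev, *A decomposition of smooth simply-connected h-cobordant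
4-manifolds*, J. Differential Geom. 44 (1996), 571–582, arXiv:dg-ga/9505001, proof of part 2 of the
Theorem and fig. 2) — in the universe instance `.{u, 0}` consumed by
`Literature.Topology.FourManifolds.corkDecomposition_of_facts` (`CorkDecompositionAssembly.lean`) — from ONE named fact of
general differential topology, the existence of *seam-adapted witnesses* of a gluing along the
boundary (`Literature.Topology.FourManifolds.exists_seamAdaptedWitnesses`, the compatibility of collars; Hirsch, *Differential
Topology* (1976), Ch. 8, Thm. 1.8–1.9 and §2).

**The statement `(S)`.** For `X = A ∪_φ B`, `S = C ∪_χ D` glued from compact pieces along the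
boundary (`Literature.Topology.FourManifolds.IsBoundaryGluing`), half-discs `kA, kB, kC, kD` in the four pieces whose flat faces
correspond (`kA (0, x') = fA x'`, `kB (0, x') = φ (fA x')`, …) and *any* boundary connected sums
`P_AC = A ♮ C`, `P_BD = B ♮ D` along them (open gluings along Juhász's relation
`Literature.Topology.FourManifolds.boundaryConnectedSumRel`), some connected sum `Q = X # S` is the gluing `P_AC ∪_θ P_BD` along
`∂(A ♮ C) ≅ ∂(B ♮ D)`.

**Why a further fact is needed.** The connected sum must be taken along discs `i_X : ℝⁿ⁺² ↪ X`,
`i_S : ℝⁿ⁺² ↪ S` which agree with `jA ∘ kA` on the upper and with `jB ∘ kB ∘ reflectZero` on the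
lower closed unit half-ball (this is forced by the two relations); for arbitrary witnesses
`(jA, jB)` of the gluing `X = A ∪_φ B` the map `jA ∘ kA ∪ jB ∘ kB ∘ reflectZero` is only
piecewise smooth (it has a crease along the seam). That witnesses can be *chosen* adapted to the
half-discs is the uniqueness-of-collars step in Hirsch's proof of the smoothing theorem 8.1.9
(replace `jB` by `jB ∘ β` for a diffeomorphism `β` of `B` fixing `∂B`): this is
`Literature.Topology.FourManifolds.exists_seamAdaptedWitnesses` (§1), a named fact here (D-0014), whose proof needs an extension
theorem for smooth functions on a half space (Seeley) and the collar-uniqueness splice, neither in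
Mathlib.

**The proof of `(S)` from adapted witnesses** (§5–§10) is Matveyev's fig. 2 made explicit:
* `Q := X # S` is the pushout of the punctured manifolds along Kervaire–Milnor's relation for the
  straddling discs (`Literature.Topology.FourManifolds.ConnectedSumData.glueData`, the tree's `SmoothGlueData.Glued` of
  `GluingConstruction.lean`; `IsConnectedSum` by construction, §6);
* `e : A ♮ C → Q`, `ιA a ↦ inl (jA a)`, `ιC c ↦ inr (jC c)` and `e' : B ♮ D → Q` likewise with
  `jB, jD` (`Literature.Topology.FourManifolds.PieceMaps.glueMap`, §7) are well defined because Juhász's relation along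
  `kA, kC` *is* Kervaire–Milnor's along `i_X, i_S` (`Literature.Topology.FourManifolds.SeamSide.first_compat`,
  `second_compat`, using that `i_X (t • u)` lies in `jA (A)` iff `u₀ ≥ 0`), and are smooth
  embeddings (immersions by the chart-lifting lemmas of §2–§3, closed embeddings by compactness);
* the boundary data: `∂(A ♮ C)` is `Σ = ∂A # ∂C`, the connected sum of the closed manifolds
  `∂A`, `∂C` along the flat faces `fA`, `fC` (again a `SmoothGlueData.Glued`), embedded by
  `incl_A # incl_C` (`Literature.Topology.FourManifolds.SplitPiece.boundaryData`, §8: an injective immersion of a compact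
  manifold whose image is the boundary, by invariance of the boundary under open smooth
  embeddings); `∂(B ♮ D)` is *the same* `Σ` embedded by `(incl_B ∘ φ) # (incl_D ∘ χ)`, so that
  `θ = id`;
* `e (P_AC) ∪ e' (P_BD) = Q` and `e p = e' q ↔ p = incl z ∧ q = incl' z`
  (`Literature.Topology.FourManifolds.SeamSide.eAC_eq_eBD_iff`, §9): the only non-obvious case is a point `inl (jA a) = inr (jD d)`
  identified across the tube of the connected sum, which forces the gluing parameter `u` onto the
  equator `u₀ = 0`, where the discs pass through the seams (`Literature.Topology.FourManifolds.SeamSide.seam_point`).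

## Main statements

* `Literature.Topology.FourManifolds.exists_seamAdaptedWitnesses` (named fact, §1).
* `Literature.Topology.FourManifolds.SeamSide.exists_isConnectedSum_isBoundaryGluing`: fig. 2 for seam-adapted data.
* `Literature.Topology.FourManifolds.exists_isConnectedSum_isBoundaryGluing_of_halfDiscs_of_seamAdapted`:
  `exists_seamAdaptedWitnesses.{u,u} → exists_seamAdaptedWitnesses.{u,0} →
  exists_isConnectedSum_isBoundaryGluing_of_halfDiscs.{u,0}`.
* `Literature.Topology.FourManifolds.corkDecomposition_of_partOne_fact_seamAdapted`: the cork theorem from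
  `Matveyev1996_partOne_and_fact` (Matveyev's part 1 and "Fact") and seam adaptation alone.

Generalities proved on the way (general models with corners unless stated): immersions pre/post-
composed with partial diffeomorphisms, restricted to open subsets of source or target, change of
complement by a dimension count (§2); open smooth embeddings are local diffeomorphisms and preserve
the boundary, the boundary of the half space and of half-discs (§2); maps out of a glued space
`SmoothGlueData.lift` and their smoothness/immersivity (§3); the flat face map of a half-disc is a
smooth open embedding `ℝⁿ⁺¹ ↪ ∂A` (§5).

## References

* R. Matveyev, *A decomposition of smooth simply-connected h-cobordant 4-manifolds*,
  J. Differential Geom. 44 (1996), 571–582; arXiv:dg-ga/9505001 (proof of part 2, fig. 2).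
* M. W. Hirsch, *Differential Topology*, GTM 33 (1976), Ch. 8 §1, Thm. 1.8 (ambient tubular
  neighbourhood theorem), Thm. 1.9 (smoothing theorem) and their proofs, pp. 181–182; Ch. 8 §2
  (gluing manifolds together, uniqueness of gluing Thm. 2.1), p. 184.
* J. R. Munkres, *Elementary Differential Topology*, Ann. of Math. Studies 54 (1966), §6.
* A. Juhász, *Differential and Low-Dimensional Topology* (2023), Def. 1.44, Def. 1.47.
* M. Kervaire, J. Milnor, *Groups of homotopy spheres I*, Ann. of Math. 77 (1963), §2.
* A. Kosinski, *Differential Manifolds* (1993), VI.1.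
-/

open scoped Manifold ContDiff Topology
open Set Function Metric Module OpenPartialHomeomorph Topology

noncomputable section

namespace Literature.Topology.FourManifolds

universe u v

/-- Local notation: `𝔼 n` is the model Euclidean space `EuclideanSpace ℝ (Fin n)`. -/
local notation "𝔼 " n:arg => EuclideanSpace ℝ (Fin n)

/-- Local notation: `ℍ n` is the closed half space `EuclideanHalfSpace n`. -/
local notation "ℍ " n:arg => EuclideanHalfSpace n

/-! ### §0 The reflection in the flat face -/

section Reflect

variable {m : ℕ}

/-- **Reflection in the boundary hyperplane of the half space**: `(x₀, x') ↦ (-x₀, x')` on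
`ℝᵐ⁺¹`, the map exchanging the closed half space `{x₀ ≥ 0}` and its mirror image `{x₀ ≤ 0}`
(used to parametrise the second half of a disc straddling the seam of a gluing). [folklore] -/
def reflectZero (y : 𝔼 (m + 1)) : 𝔼 (m + 1) :=
  WithLp.toLp 2 (Fin.cons (-(y 0)) fun i => y i.succ)

/-- The reflection negates the height. [folklore] -/
@[simp] theorem reflectZero_apply_zero (y : 𝔼 (m + 1)) : reflectZero y 0 = -(y 0) := by
  simp [reflectZero]

/-- The reflection fixes the tangential coordinates. [folklore] -/
@[simp] theorem reflectZero_apply_succ (y : 𝔼 (m + 1)) (i : Fin m) :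
    reflectZero y i.succ = y i.succ := by
  simp [reflectZero]

/-- The reflection is an involution. [folklore] -/
@[simp] theorem reflectZero_reflectZero (y : 𝔼 (m + 1)) : reflectZero (reflectZero y) = y := by
  ext i
  refine Fin.cases ?_ (fun j => ?_) i
  · simp
  · simp

/-- The reflection fixes the origin. [folklore] -/
@[simp] theorem reflectZero_zero : reflectZero (0 : 𝔼 (m + 1)) = 0 := by
  ext i
  refine Fin.cases ?_ (fun j => ?_) i <;> simp

/-- The reflection commutes with scalar multiplication. [folklore] -/
theorem reflectZero_smul (t : ℝ) (y : 𝔼 (m + 1)) : reflectZero (t • y) = t • reflectZero y := by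
  ext i
  refine Fin.cases ?_ (fun j => ?_) i
  · simp
  · simp

/-- The reflection preserves the Euclidean norm. [folklore] -/
@[simp] theorem norm_reflectZero (y : 𝔼 (m + 1)) : ‖reflectZero y‖ = ‖y‖ := by
  simp only [EuclideanSpace.norm_eq, Fin.sum_univ_succ, reflectZero_apply_zero, norm_neg,
    reflectZero_apply_succ]

/-- The reflection fixes the boundary hyperplane `{x₀ = 0}` pointwise. [folklore] -/
theorem reflectZero_of_apply_zero {y : 𝔼 (m + 1)} (hy : y 0 = 0) : reflectZero y = y := by
  ext i
  refine Fin.cases ?_ (fun j => ?_) i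
  · simp [hy]
  · simp

/-- The reflection fixes the flat face of the half space pointwise. [folklore] -/
@[simp] theorem reflectZero_face (x' : 𝔼 m) :
    reflectZero (EuclideanHalfSpace.face x').val = (EuclideanHalfSpace.face x').val :=
  reflectZero_of_apply_zero (EuclideanHalfSpace.val_face_apply_zero x')

/-- A vector with nonpositive height reflects into the closed half space. [folklore] -/
theorem reflectZero_mem_halfSpace {y : 𝔼 (m + 1)} (hy : y 0 ≤ 0) : 0 ≤ reflectZero y 0 := by
  rw [reflectZero_apply_zero]; linarith

end Reflect

/-! ### §1 The named fact: seam-adapted gluing witnesses -/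

section Fact

/-- **Seam-adapted witnesses of a gluing along the boundary (compatibility of collars).** Let
`X = A ∪_φ B` be a smooth `(n+2)`-manifold glued from compact smooth manifolds with boundary along
a diffeomorphism `φ : ∂A ≅ ∂B` (`Literature.Topology.FourManifolds.IsBoundaryGluing`), and let `kA : ℝⁿ⁺²₊ ↪ A`,
`kB : ℝⁿ⁺²₊ ↪ B` be half-discs (smooth embeddings of the closed half space with open range) whose
flat faces correspond under `φ`: `kA (0, x') = fA x'`, `kB (0, x') = φ (fA x')`. Then the gluing
admits witnesses — smooth embeddings `jA : A → X`, `jB : B → X` covering `X` and meeting exactly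
along `∂A ≡_φ ∂B` — for which the two half-discs fit together smoothly across the seam: there is
a smooth disc `i : ℝⁿ⁺² ↪ X` (smooth embedding with open range) with `i (x₀, x') = jA (kA (x₀, x'))`
and `i (-x₀, x') = jB (kB (x₀, x'))` for `x₀ ≥ 0`, `‖(x₀, x')‖ ≤ 1`. In print this is the
*uniqueness of collars* / *smoothing of the seam*: any witnesses `(jA, jB)` become adapted after
replacing `jB` by `jB ∘ β` for a diffeomorphism `β` of `B` which is the identity on `∂B` (and
outside a neighbourhood of the face disc), obtained by extending `jA ∘ kA` smoothly across the
seam and splicing the resulting collar of `∂B` with the given one — the step "isotop `h|M₀` to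
`f'` such that `f'(τ₀|M₀)` has the same `V₁`-germ as `τ₁|M₁`" of Hirsch's proof of the smoothing
theorem (*Differential Topology* (1976), Ch. 8, Thm. 1.9, via the ambient tubular neighbourhood
theorem 1.8; see also §2 there, Munkres, *Elementary Differential Topology* (1966), §6, and
Bröcker–Jänich, *Introduction to Differential Topology* (1982), §13).
Absent from Mathlib (no collars, no extension of smooth functions across a boundary).
[cite: Hirsch1976, Ch. 8 §1, proof of Thm. 1.9 (with Thm. 1.8), pp. 181–182; §2, p. 184] -/
def exists_seamAdaptedWitnesses : Prop :=
  ∀ (n : ℕ) (A B : Type u) (X : Type v)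
    [TopologicalSpace A] [T2Space A] [SecondCountableTopology A]
    [ChartedSpace (ℍ (n + 2)) A] [IsManifold (𝓡∂ (n + 2)) ∞ A] [CompactSpace A]
    [TopologicalSpace B] [T2Space B] [SecondCountableTopology B]
    [ChartedSpace (ℍ (n + 2)) B] [IsManifold (𝓡∂ (n + 2)) ∞ B] [CompactSpace B]
    [TopologicalSpace X] [T2Space X] [SecondCountableTopology X] [ChartedSpace (𝔼 (n + 2)) X]
    [IsManifold (𝓡 (n + 2)) ∞ X]
    (bA : BoundaryData (𝓡∂ (n + 2)) A (𝓡 (n + 1))) (bB : BoundaryData (𝓡∂ (n + 2)) B (𝓡 (n + 1)))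
    (φ : bA.carrier ≃ₘ⟮𝓡 (n + 1), 𝓡 (n + 1)⟯ bB.carrier)
    (kA : ℍ (n + 2) → A) (kB : ℍ (n + 2) → B) (fA : 𝔼 (n + 1) → bA.carrier),
    IsBoundaryGluing bA bB φ (𝓡 (n + 2)) X →
    Manifold.IsSmoothEmbedding (𝓡∂ (n + 2)) (𝓡∂ (n + 2)) ∞ kA → IsOpen (range kA) →
    Manifold.IsSmoothEmbedding (𝓡∂ (n + 2)) (𝓡∂ (n + 2)) ∞ kB → IsOpen (range kB) →
    (∀ x', kA (EuclideanHalfSpace.face x') = bA.incl (fA x')) →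
    (∀ x', kB (EuclideanHalfSpace.face x') = bB.incl (φ (fA x'))) →
      ∃ (jA : A → X) (jB : B → X) (i : 𝔼 (n + 2) → X),
        Manifold.IsSmoothEmbedding (𝓡∂ (n + 2)) (𝓡 (n + 2)) ∞ jA ∧
        Manifold.IsSmoothEmbedding (𝓡∂ (n + 2)) (𝓡 (n + 2)) ∞ jB ∧
        range jA ∪ range jB = univ ∧
        (∀ a b, jA a = jB b ↔ ∃ z, a = bA.incl z ∧ b = bB.incl (φ z)) ∧
        Manifold.IsSmoothEmbedding 𝓘(ℝ, 𝔼 (n + 2)) (𝓡 (n + 2)) ∞ i ∧ IsOpen (range i) ∧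
        (∀ x : ℍ (n + 2), ‖x.val‖ ≤ 1 → i x.val = jA (kA x)) ∧
        (∀ x : ℍ (n + 2), ‖x.val‖ ≤ 1 → i (reflectZero x.val) = jB (kB x))

end Fact

/-! ### §2 Generalities: immersions and local diffeomorphisms, boundary invariance -/

section Immersion

variable {EM HM EN HN : Type*} [NormedAddCommGroup EM] [NormedSpace ℝ EM] [TopologicalSpace HM]
  [NormedAddCommGroup EN] [NormedSpace ℝ EN] [TopologicalSpace HN]
  {I : ModelWithCorners ℝ EM HM} {J : ModelWithCorners ℝ EN HN}
  {F : Type*} [NormedAddCommGroup F] [NormedSpace ℝ F]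
  {M : Type*} [TopologicalSpace M] [ChartedSpace HM M]
  {M' : Type*} [TopologicalSpace M'] [ChartedSpace HM M']
  {N : Type*} [TopologicalSpace N] [ChartedSpace HN N]
  {N' : Type*} [TopologicalSpace N'] [ChartedSpace HN N']
  {f : M → N} {x : M}

/-- **An immersion postcomposed with a partial diffeomorphism is an immersion** (same
complement): if `f` is a `C^∞` immersion at `x` and `Ψ : N ⇀ N'` is an open partial
homeomorphism between manifolds with the same model, `C^∞` with `C^∞` inverse, with
`f x ∈ Ψ.source`, then `Ψ ∘ f` is an immersion at `x` (use the chart `Ψ.symm ≫ codChart` and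
restrict the domain chart to `f ⁻¹' Ψ.source`). General models; the global version for a
diffeomorphism is the tree's `IsImmersionAtOfComplement.diffeomorph_comp` (`ClosedBallProofs.lean`).
[folklore] -/
theorem _root_.Manifold.IsImmersionAtOfComplement.openPartialHomeomorph_comp [IsManifold I ∞ M]
    [IsManifold J ∞ N']
    (hf : Manifold.IsImmersionAtOfComplement F I J ∞ f x) (Ψ : OpenPartialHomeomorph N N')
    (hΨ : ContMDiffOn J J ∞ Ψ Ψ.source) (hΨ' : ContMDiffOn J J ∞ Ψ.symm Ψ.target)
    (hfx : f x ∈ Ψ.source) :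
    Manifold.IsImmersionAtOfComplement F I J ∞ (Ψ ∘ f) x := by
  -- restrict the domain chart to an open set on which `f` maps into `Ψ.source`
  set s : Set M := hf.domChart.source ∩ f ⁻¹' Ψ.source with hs
  have hso : IsOpen s := hf.continuousOn.isOpen_inter_preimage hf.domChart.open_source Ψ.open_source
  have hxs : x ∈ s := ⟨hf.mem_domChart_source, hfx⟩
  have hdom : hf.domChart.restr s ∈ IsManifold.maximalAtlas I ∞ M :=
    restr_mem_maximalAtlas _ hf.domChart_mem_maximalAtlas hso
  have hcod : Ψ.symm ≫ₕ hf.codChart ∈ IsManifold.maximalAtlas J ∞ N' := by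
    apply OpenPartialHomeomorph.mem_maximalAtlas_of_contMDiffOn
    · rw [trans_source, coe_trans]
      exact (contMDiffOn_of_mem_maximalAtlas hf.codChart_mem_maximalAtlas).comp
        (hΨ'.mono inter_subset_left) fun z hz => hz.2
    · rw [trans_symm_eq_symm_trans_symm, trans_target, coe_trans, symm_symm]
      refine hΨ.comp
        ((contMDiffOn_symm_of_mem_maximalAtlas hf.codChart_mem_maximalAtlas).mono
          inter_subset_left) (fun z hz => ?_)
      have := hz.2
      simp only [mem_preimage, symm_target] at this
      exact this
  have hcont : ContinuousAt (Ψ ∘ f) x :=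
    ((hΨ.continuousOn.continuousWithinAt hfx).continuousAt (Ψ.open_source.mem_nhds hfx)).comp
      hf.continuousAt
  refine Manifold.IsImmersionAtOfComplement.mk_of_continuousAt hcont hf.equiv
    (hf.domChart.restr s) (Ψ.symm ≫ₕ hf.codChart) ?_ ?_ hdom hcod ?_
  · rw [hf.domChart.restr_source' _ hso]; exact ⟨hf.mem_domChart_source, hxs⟩
  · simp only [trans_source, symm_source, mem_inter_iff, mem_preimage, comp_apply]
    exact ⟨Ψ.map_source hfx, by rw [Ψ.left_inv hfx]; exact hf.mem_codChart_source⟩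
  · intro u hu
    have hu' : u ∈ (hf.domChart.extend I).target := by
      simp only [extend_target, restr_target, mem_inter_iff, mem_preimage, hso.interior_eq] at hu ⊢
      exact ⟨hu.1.1, hu.2⟩
    have hmem : hf.domChart.symm (I.symm u) ∈ s := by
      simp only [extend_target, restr_target, mem_inter_iff, mem_preimage, hso.interior_eq] at hu
      exact hu.1.2
    have h := hf.writtenInCharts hu'
    simp only [comp_apply, extend_coe, extend_coe_symm, coe_trans, restr_symm_apply] at h ⊢
    rw [Ψ.left_inv hmem.2]
    exact h

/-- The coercion partial homeomorphism `U ⇀ M` of an open subset is smooth. [folklore] -/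
theorem contMDiffOn_openPartialHomeomorphSubtypeCoe (U : TopologicalSpace.Opens M) (hU : Nonempty U) :
    ContMDiffOn I I ∞ (U.openPartialHomeomorphSubtypeCoe hU)
      (U.openPartialHomeomorphSubtypeCoe hU).source := by
  rw [TopologicalSpace.Opens.openPartialHomeomorphSubtypeCoe_source]
  exact (contMDiff_subtype_val.contMDiffOn (s := univ)).congr fun z _ => by simp

/-- The inverse of the coercion partial homeomorphism `U ⇀ M` of an open subset is smooth on
`U`. [folklore] -/
theorem contMDiffOn_openPartialHomeomorphSubtypeCoe_symm (U : TopologicalSpace.Opens M)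
    (hU : Nonempty U) :
    ContMDiffOn I I ∞ (U.openPartialHomeomorphSubtypeCoe hU).symm
      (U.openPartialHomeomorphSubtypeCoe hU).target := by
  set c := U.openPartialHomeomorphSubtypeCoe hU
  have key : EqOn (Subtype.val ∘ c.symm) id c.target := fun w hw => c.right_inv hw
  intro z hz
  have h1 : ContMDiffWithinAt I I ∞ (Subtype.val ∘ c.symm) c.target z :=
    contMDiffWithinAt_id.congr key (key hz)
  exact (ContMDiffWithinAt.subtypeVal_comp_iff U _ _ _).1 h1

/-- **An immersion restricted to an open subset of the source is an immersion** (same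
complement). General models. [folklore] -/
theorem _root_.Manifold.IsImmersionAtOfComplement.comp_subtypeVal [IsManifold I ∞ M]
    (U : TopologicalSpace.Opens M) {y : U}
    (hf : Manifold.IsImmersionAtOfComplement F I J ∞ f y.val) :
    Manifold.IsImmersionAtOfComplement F I J ∞ (f ∘ Subtype.val : U → N) y := by
  haveI hU : Nonempty U := ⟨y⟩
  exact Manifold.IsImmersionAtOfComplement.comp_openPartialHomeomorph (f := f)
    (U.openPartialHomeomorphSubtypeCoe hU) (contMDiffOn_openPartialHomeomorphSubtypeCoe U hU)
    (contMDiffOn_openPartialHomeomorphSubtypeCoe_symm U hU) (x := y) (by simp) hf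

/-- **An immersion corestricted to an open subset of the target containing its image is an
immersion** (same complement). General models. [folklore] -/
theorem _root_.Manifold.IsImmersionAtOfComplement.codRestrict_opens [IsManifold I ∞ M]
    [IsManifold J ∞ N] (U : TopologicalSpace.Opens N)
    (hU : ∀ y, f y ∈ U) (hf : Manifold.IsImmersionAtOfComplement F I J ∞ f x) :
    Manifold.IsImmersionAtOfComplement F I J ∞ (fun y => (⟨f y, hU y⟩ : U)) x := by
  haveI hne : Nonempty U := ⟨⟨f x, hU x⟩⟩
  set c := U.openPartialHomeomorphSubtypeCoe hne
  have hΨs : ContMDiffOn J J ∞ c.symm c.symm.source :=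
    contMDiffOn_openPartialHomeomorphSubtypeCoe_symm U hne
  have hΨ's : ContMDiffOn J J ∞ c.symm.symm c.symm.target := by
    rw [symm_symm, symm_target]
    exact contMDiffOn_openPartialHomeomorphSubtypeCoe U hne
  have hfx : f x ∈ c.symm.source := by simp [c, hU x]
  have h := hf.openPartialHomeomorph_comp c.symm hΨs hΨ's hfx
  refine h.congr_of_eventuallyEq (Filter.Eventually.of_forall fun y => ?_)
  apply Subtype.ext
  change (c.symm (f y)).val = f y
  exact c.right_inv (by simp [c, hU y])

/-- **Change of complement along a dimension count.** An immersion at `x` with some complement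
`F` (finite-dimensional models) is an immersion with any complement `F₀` of the right dimension
`dim E + dim F₀ = dim E'`. [folklore] -/
theorem _root_.Manifold.IsImmersionAtOfComplement.of_finrank_eq [FiniteDimensional ℝ EM]
    [FiniteDimensional ℝ EN]
    {F₀ : Type*} [NormedAddCommGroup F₀] [NormedSpace ℝ F₀] [FiniteDimensional ℝ F₀]
    (hf : Manifold.IsImmersionAtOfComplement F I J ∞ f x)
    (hdim : finrank ℝ EM + finrank ℝ F₀ = finrank ℝ EN) :
    Manifold.IsImmersionAtOfComplement F₀ I J ∞ f x := by
  have e := hf.equiv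
  haveI : FiniteDimensional ℝ (EM × F) := LinearEquiv.finiteDimensional e.toLinearEquiv.symm
  haveI : FiniteDimensional ℝ F :=
    Module.Finite.of_injective (LinearMap.inr ℝ EM F) LinearMap.inr_injective
  have h1 : finrank ℝ (EM × F) = finrank ℝ EN := e.toLinearEquiv.finrank_eq
  rw [Module.finrank_prod] at h1
  have h2 : finrank ℝ F = finrank ℝ F₀ := by omega
  exact (Manifold.IsImmersionAtOfComplement.congr_F (ContinuousLinearEquiv.ofFinrankEq h2)).1 hf

/-- A `C^∞` immersion between manifolds with finite-dimensional models of dimensions `d` and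
`d + dim F₀` is an immersion with complement `F₀` at every point. [folklore] -/
theorem _root_.Manifold.IsImmersion.isImmersionOfComplement_of_finrank_eq [FiniteDimensional ℝ EM]
    [FiniteDimensional ℝ EN] {F₀ : Type*} [NormedAddCommGroup F₀] [NormedSpace ℝ F₀]
    [FiniteDimensional ℝ F₀] (hf : Manifold.IsImmersion I J ∞ f)
    (hdim : finrank ℝ EM + finrank ℝ F₀ = finrank ℝ EN) :
    Manifold.IsImmersionOfComplement F₀ I J ∞ f := by
  obtain ⟨F, _, _, hF⟩ := hf
  exact fun y => (hF y).of_finrank_eq hdim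

end Immersion

section LocalDiffeo

variable {EM HM EN HN : Type*} [NormedAddCommGroup EM] [NormedSpace ℝ EM] [TopologicalSpace HM]
  [NormedAddCommGroup EN] [NormedSpace ℝ EN] [TopologicalSpace HN]
  {I : ModelWithCorners ℝ EM HM} {J : ModelWithCorners ℝ EN HN}
  {M : Type*} [TopologicalSpace M] [ChartedSpace HM M]
  {N : Type*} [TopologicalSpace N] [ChartedSpace HN N]

/-- The open partial homeomorphism of an open smooth embedding (source `univ`, target the
range). [folklore] -/
def openEmbeddingChart [Nonempty M] {f : M → N} (hf : Manifold.IsSmoothEmbedding I J ∞ f)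
    (ho : IsOpen (range f)) : OpenPartialHomeomorph M N :=
  (IsOpenEmbedding.mk hf.isEmbedding ho : IsOpenEmbedding f).toOpenPartialHomeomorph f

variable [Nonempty M] {f : M → N} (hf : Manifold.IsSmoothEmbedding I J ∞ f) (ho : IsOpen (range f))

/-- The chart of an open embedding is the embedding. [folklore] -/
@[simp] theorem openEmbeddingChart_coe : ⇑(openEmbeddingChart hf ho) = f := rfl

/-- Its source is everything. [folklore] -/
@[simp] theorem openEmbeddingChart_source : (openEmbeddingChart hf ho).source = univ := by
  simp [openEmbeddingChart]

/-- Its target is the range. [folklore] -/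
@[simp] theorem openEmbeddingChart_target : (openEmbeddingChart hf ho).target = range f := by
  simp [openEmbeddingChart]

/-- Its inverse is a left inverse of the embedding. [folklore] -/
theorem openEmbeddingChart_symm_apply (a : M) : (openEmbeddingChart hf ho).symm (f a) = a :=
  (openEmbeddingChart hf ho).left_inv (by simp)

/-- Its inverse is a right inverse on the range. [folklore] -/
theorem apply_openEmbeddingChart_symm {p : N} (hp : p ∈ range f) :
    f ((openEmbeddingChart hf ho).symm p) = p :=
  (openEmbeddingChart hf ho).right_inv (by simpa using hp)

/-- The chart of an open smooth embedding is smooth. [folklore] -/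
theorem contMDiffOn_openEmbeddingChart :
    ContMDiffOn I J ∞ (openEmbeddingChart hf ho) (openEmbeddingChart hf ho).source :=
  hf.contMDiff.contMDiffOn

/-- The inverse chart of an open smooth embedding is smooth on the range. [folklore] -/
theorem contMDiffOn_openEmbeddingChart_symm :
    ContMDiffOn J I ∞ (openEmbeddingChart hf ho).symm (openEmbeddingChart hf ho).target := by
  rw [openEmbeddingChart_target]
  exact contMDiffOn_symm_of_isSmoothEmbedding hf _

/-- The partial diffeomorphism of an open smooth embedding. [folklore] -/
def openEmbeddingPartialDiffeomorph : PartialDiffeomorph I J M N ∞ where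
  toPartialEquiv := (openEmbeddingChart hf ho).toPartialEquiv
  open_source := (openEmbeddingChart hf ho).open_source
  open_target := (openEmbeddingChart hf ho).open_target
  contMDiffOn_toFun := contMDiffOn_openEmbeddingChart hf ho
  contMDiffOn_invFun := contMDiffOn_openEmbeddingChart_symm hf ho

include hf ho in
/-- **An open smooth embedding is a local diffeomorphism.** [folklore] -/
theorem isLocalDiffeomorph_of_isSmoothEmbedding_of_isOpen_range : IsLocalDiffeomorph I J ∞ f :=
  fun a => ⟨openEmbeddingPartialDiffeomorph hf ho, by
    change a ∈ (openEmbeddingChart hf ho).source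
    simp, fun _ _ => rfl⟩

omit [Nonempty M] in
/-- **Open smooth embeddings preserve boundary points**: for an open smooth embedding `f`,
`f a ∈ ∂N ↔ a ∈ ∂M`. [folklore] -/
theorem mem_boundary_iff_of_isSmoothEmbedding (hf : Manifold.IsSmoothEmbedding I J ∞ f)
    (ho : IsOpen (range f)) (a : M) : f a ∈ J.boundary N ↔ a ∈ I.boundary M := by
  haveI : Nonempty M := ⟨a⟩
  have h := (isLocalDiffeomorph_of_isSmoothEmbedding_of_isOpen_range hf ho).preimage_boundary
    (by simp)
  rw [← mem_preimage, h]

omit [Nonempty M] in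
/-- **Boundary points of an open submanifold** are the boundary points of the ambient manifold
lying in it. [folklore] -/
theorem mem_boundary_opens_iff [IsManifold I ∞ M] (U : TopologicalSpace.Opens M) (a : U) :
    a ∈ I.boundary U ↔ a.val ∈ I.boundary M := by
  have himm : Manifold.IsImmersionOfComplement PUnit.{1} I I ∞ (Subtype.val : U → M) :=
    Manifold.IsImmersionOfComplement.of_opens U
  have hval : Manifold.IsSmoothEmbedding I I ∞ (Subtype.val : U → M) :=
    ⟨himm.isImmersion, IsEmbedding.subtypeVal⟩
  have ho : IsOpen (range (Subtype.val : U → M)) := by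
    rw [Subtype.range_coe]; exact U.isOpen
  exact (mem_boundary_iff_of_isSmoothEmbedding hval ho a).symm

end LocalDiffeo

section HalfSpaceBoundary

variable {m : ℕ} [NeZero m]

/-- The boundary of the closed half space `ℝᵐ₊` (as a manifold with boundary modelled on itself)
is the hyperplane `{x₀ = 0}`. [folklore] -/
theorem mem_boundary_halfSpace_iff (x : ℍ m) : x ∈ (𝓡∂ m).boundary (ℍ m) ↔ x.val 0 = 0 := by
  change (𝓡∂ m).IsBoundaryPoint x ↔ _
  rw [ModelWithCorners.isBoundaryPoint_iff, extChartAt_self_apply,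
    frontier_range_modelWithCornersEuclideanHalfSpace]
  change (0 = x.val 0) ↔ x.val 0 = 0
  exact eq_comm

variable {A : Type*} [TopologicalSpace A] [ChartedSpace (ℍ m) A]

/-- **A half-disc meets the boundary exactly along its flat face**: for a smooth embedding
`k : ℝᵐ₊ → A` of the closed half space with open range, `k x ∈ ∂A ↔ x₀ = 0`. [folklore] -/
theorem halfDisc_mem_boundary_iff {k : ℍ m → A}
    (hk : Manifold.IsSmoothEmbedding (𝓡∂ m) (𝓡∂ m) ∞ k) (hko : IsOpen (range k)) (x : ℍ m) :
    k x ∈ (𝓡∂ m).boundary A ↔ x.val 0 = 0 := by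
  rw [mem_boundary_iff_of_isSmoothEmbedding hk hko, mem_boundary_halfSpace_iff]

end HalfSpaceBoundary

/-! ### §3 Maps out of a glued space -/

namespace SmoothGlueData

variable {E_A H_A E_B H_B : Type*}
  [NormedAddCommGroup E_A] [NormedSpace ℝ E_A] [TopologicalSpace H_A]
  [NormedAddCommGroup E_B] [NormedSpace ℝ E_B] [TopologicalSpace H_B]
  {I_A : ModelWithCorners ℝ E_A H_A} {I_B : ModelWithCorners ℝ E_B H_B}
  {A : Type u} [TopologicalSpace A] [ChartedSpace H_A A]
  {B : Type v} [TopologicalSpace B] [ChartedSpace H_B B]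
  {E_P : Type*} [NormedAddCommGroup E_P] [NormedSpace ℝ E_P]
  (d : SmoothGlueData I_A I_B A B E_P) {Z : Type*}

/-- **The universal property of the glued space** (as a set): a pair of maps `fA : A → Z`,
`fB : B → Z` compatible with the gluing map descends to `A ∪_glue B → Z`. [folklore] -/
def lift (fA : A → Z) (fB : B → Z) (h : ∀ a ∈ d.glue.source, fA a = fB (d.glue a)) :
    d.Glued → Z :=
  Quotient.lift (Sum.elim fA fB) (by
    rintro (a | b) (a' | b') hr
    · change a = a' at hr; simp [hr]
    · change a ∈ d.glue.source ∧ d.glue a = b' at hr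
      simp only [Sum.elim_inl, Sum.elim_inr]; rw [h a hr.1, hr.2]
    · change a' ∈ d.glue.source ∧ d.glue a' = b at hr
      simp only [Sum.elim_inl, Sum.elim_inr]; rw [h a' hr.1, hr.2]
    · change b = b' at hr; simp [hr])

variable {fA : A → Z} {fB : B → Z} {h : ∀ a ∈ d.glue.source, fA a = fB (d.glue a)}

/-- The descended map on the first piece. [folklore] -/
@[simp] theorem lift_inl (a : A) : d.lift fA fB h (d.inl a) = fA a := rfl

/-- The descended map on the second piece. [folklore] -/
@[simp] theorem lift_inr (b : B) : d.lift fA fB h (d.inr b) = fB b := rfl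

/-- The descended map restricted along `inl`. [folklore] -/
theorem lift_comp_inl : d.lift fA fB h ∘ d.inl = fA := rfl

/-- The descended map restricted along `inr`. [folklore] -/
theorem lift_comp_inr : d.lift fA fB h ∘ d.inr = fB := rfl

/-- A descended map is continuous if both components are. [folklore] -/
theorem continuous_lift [TopologicalSpace Z] (hA : Continuous fA) (hB : Continuous fB) :
    Continuous (d.lift fA fB h) := by
  rw [d.isQuotientMap_proj.continuous_iff]
  exact hA.sumElim hB

/-- The range of a descended map is the union of the ranges of its components. [folklore] -/
theorem range_lift : range (d.lift fA fB h) = range fA ∪ range fB := by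
  ext z
  constructor
  · rintro ⟨p, rfl⟩
    rcases d.exists_inl_or_inr p with ⟨a, rfl⟩ | ⟨b, rfl⟩
    · exact Or.inl ⟨a, rfl⟩
    · exact Or.inr ⟨b, rfl⟩
  · rintro (⟨a, rfl⟩ | ⟨b, rfl⟩)
    · exact ⟨d.inl a, rfl⟩
    · exact ⟨d.inr b, rfl⟩

end SmoothGlueData

namespace SmoothGlueData

variable {E_A H_A E_B H_B : Type*}
  [NormedAddCommGroup E_A] [NormedSpace ℝ E_A] [TopologicalSpace H_A]
  [NormedAddCommGroup E_B] [NormedSpace ℝ E_B] [TopologicalSpace H_B]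
  {I_A : ModelWithCorners ℝ E_A H_A} {I_B : ModelWithCorners ℝ E_B H_B}
  {A : Type u} [TopologicalSpace A] [ChartedSpace H_A A]
  {B : Type v} [TopologicalSpace B] [ChartedSpace H_B B]
  {E_P : Type*} [NormedAddCommGroup E_P] [NormedSpace ℝ E_P]
  (d : SmoothGlueData I_A I_B A B E_P)
  [I_A.Boundaryless] [I_B.Boundaryless] [IsManifold I_A ∞ A] [IsManifold I_B ∞ B]
  {E_Z H_Z : Type*} [NormedAddCommGroup E_Z] [NormedSpace ℝ E_Z] [TopologicalSpace H_Z]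
  {I_Z : ModelWithCorners ℝ E_Z H_Z} {Z : Type*} [TopologicalSpace Z] [ChartedSpace H_Z Z]
  {fA : A → Z} {fB : B → Z} {h : ∀ a ∈ d.glue.source, fA a = fB (d.glue a)}

/-- The inverse of `inl` on its (open) range, as an open partial homeomorphism `A ∪ B ⇀ A`,
is smooth. [folklore] -/
theorem contMDiffOn_inlChart_symm [Nonempty A] :
    ContMDiffOn 𝓘(ℝ, E_P) I_A ∞ (openEmbeddingChart d.isSmoothEmbedding_inl d.isOpen_range_inl).symm
      (range d.inl) :=
  contMDiffOn_symm_of_isSmoothEmbedding d.isSmoothEmbedding_inl _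

/-- The inverse of `inr` on its (open) range is smooth. [folklore] -/
theorem contMDiffOn_inrChart_symm [Nonempty B] :
    ContMDiffOn 𝓘(ℝ, E_P) I_B ∞ (openEmbeddingChart d.isSmoothEmbedding_inr d.isOpen_range_inr).symm
      (range d.inr) :=
  contMDiffOn_symm_of_isSmoothEmbedding d.isSmoothEmbedding_inr _

/-- **A descended map is smooth if both components are.** [folklore] -/
theorem contMDiff_lift (hA : ContMDiff I_A I_Z ∞ fA) (hB : ContMDiff I_B I_Z ∞ fB) :
    ContMDiff 𝓘(ℝ, E_P) I_Z ∞ (d.lift fA fB h) := by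
  intro p
  rcases d.exists_inl_or_inr p with ⟨a, rfl⟩ | ⟨b, rfl⟩
  · haveI : Nonempty A := ⟨a⟩
    set Φ := openEmbeddingChart d.isSmoothEmbedding_inl d.isOpen_range_inl
    have heq : EqOn (d.lift fA fB h) (fA ∘ Φ.symm) (range d.inl) := by
      rintro _ ⟨a', rfl⟩
      simp [Φ, openEmbeddingChart_symm_apply]
    have hs : ContMDiffOn 𝓘(ℝ, E_P) I_Z ∞ (fA ∘ Φ.symm) (range d.inl) :=
      hA.comp_contMDiffOn d.contMDiffOn_inlChart_symm
    exact ((hs.congr heq).contMDiffAt (d.isOpen_range_inl.mem_nhds ⟨a, rfl⟩))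
  · haveI : Nonempty B := ⟨b⟩
    set Φ := openEmbeddingChart d.isSmoothEmbedding_inr d.isOpen_range_inr
    have heq : EqOn (d.lift fA fB h) (fB ∘ Φ.symm) (range d.inr) := by
      rintro _ ⟨b', rfl⟩
      simp [Φ, openEmbeddingChart_symm_apply]
    have hs : ContMDiffOn 𝓘(ℝ, E_P) I_Z ∞ (fB ∘ Φ.symm) (range d.inr) :=
      hB.comp_contMDiffOn d.contMDiffOn_inrChart_symm
    exact ((hs.congr heq).contMDiffAt (d.isOpen_range_inr.mem_nhds ⟨b, rfl⟩))

/-- **A descended map is an immersion where its components are** (complement `F`): at a point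
`inl a`, in the lifted chart `chartA domChart` of the glued space and the codomain chart of `fA`,
the map `lift fA fB` reads `u ↦ L (e_A⁻¹ u, 0)`. [folklore] -/
theorem isImmersionAtOfComplement_lift_inl {F : Type*} [NormedAddCommGroup F] [NormedSpace ℝ F]
    (a : A) (hA : Manifold.IsImmersionAtOfComplement F I_A I_Z ∞ fA a) :
    Manifold.IsImmersionAtOfComplement F 𝓘(ℝ, E_P) I_Z ∞ (d.lift fA fB h) (d.inl a) := by
  refine Manifold.IsImmersionAtOfComplement.mk_of_charts
    ((d.linA.symm.prodCongr (ContinuousLinearEquiv.refl ℝ F)).trans hA.equiv)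
    (d.chartA hA.domChart) hA.codChart ?_ ?_
    (IsManifold.subset_maximalAtlas (d.chartA_mem_atlas hA.domChart_mem_maximalAtlas))
    hA.codChart_mem_maximalAtlas ?_ ?_
  · exact ⟨a, hA.mem_domChart_source, rfl⟩
  · simpa using hA.mem_codChart_source
  · rintro _ ⟨a', ha', rfl⟩
    simpa using hA.source_subset_preimage_source ha'
  · intro u hu
    have hu1 : I_A.symm (d.linA.symm u) ∈ hA.domChart.target := by
      simp only [extend_target, mem_inter_iff, mem_preimage, modelWithCornersSelf_coe_symm, id_eq,
        chartA, lift_openEmbedding_target, transHomeomorph_target, modelHomeoA_symm_apply] at hu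
      exact hu.1
    have hu' : d.linA.symm u ∈ (hA.domChart.extend I_A).target := by
      simp only [extend_target, mem_inter_iff, mem_preimage, I_A.range_eq_univ, mem_univ, and_true]
      exact hu1
    have hw := hA.writtenInCharts hu'
    simp only [comp_apply, extend_coe, extend_coe_symm] at hw
    simp only [comp_apply, extend_coe, extend_coe_symm, modelWithCornersSelf_coe_symm, id_eq,
      chartA, lift_openEmbedding_symm, transHomeomorph_symm_apply, modelHomeoA_symm_apply, lift_inl,
      ContinuousLinearEquiv.trans_apply, ContinuousLinearEquiv.prodCongr_apply,
      ContinuousLinearEquiv.refl_apply]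
    exact hw

/-- A descended map is an immersion at `inr b` if `fB` is an immersion at `b`. [folklore] -/
theorem isImmersionAtOfComplement_lift_inr {F : Type*} [NormedAddCommGroup F] [NormedSpace ℝ F]
    (b : B) (hB : Manifold.IsImmersionAtOfComplement F I_B I_Z ∞ fB b) :
    Manifold.IsImmersionAtOfComplement F 𝓘(ℝ, E_P) I_Z ∞ (d.lift fA fB h) (d.inr b) := by
  refine Manifold.IsImmersionAtOfComplement.mk_of_charts
    ((d.linB.symm.prodCongr (ContinuousLinearEquiv.refl ℝ F)).trans hB.equiv)
    (d.chartB hB.domChart) hB.codChart ?_ ?_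
    (IsManifold.subset_maximalAtlas (d.chartB_mem_atlas hB.domChart_mem_maximalAtlas))
    hB.codChart_mem_maximalAtlas ?_ ?_
  · exact ⟨b, hB.mem_domChart_source, rfl⟩
  · simpa using hB.mem_codChart_source
  · rintro _ ⟨b', hb', rfl⟩
    simpa using hB.source_subset_preimage_source hb'
  · intro u hu
    have hu1 : I_B.symm (d.linB.symm u) ∈ hB.domChart.target := by
      simp only [extend_target, mem_inter_iff, mem_preimage, modelWithCornersSelf_coe_symm, id_eq,
        chartB, lift_openEmbedding_target, transHomeomorph_target, modelHomeoB_symm_apply] at hu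
      exact hu.1
    have hu' : d.linB.symm u ∈ (hB.domChart.extend I_B).target := by
      simp only [extend_target, mem_inter_iff, mem_preimage, I_B.range_eq_univ, mem_univ, and_true]
      exact hu1
    have hw := hB.writtenInCharts hu'
    simp only [comp_apply, extend_coe, extend_coe_symm] at hw
    simp only [comp_apply, extend_coe, extend_coe_symm, modelWithCornersSelf_coe_symm, id_eq,
      chartB, lift_openEmbedding_symm, transHomeomorph_symm_apply, modelHomeoB_symm_apply, lift_inr,
      ContinuousLinearEquiv.trans_apply, ContinuousLinearEquiv.prodCongr_apply,
      ContinuousLinearEquiv.refl_apply]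
    exact hw

end SmoothGlueData

/-! ### §4 The flat face: complements -/

section FaceLemmas

variable {n : ℕ}

/-- Dilating a face point is the face point of the dilated vector. [cite: Juhasz2023, Def. 1.47] -/
theorem EuclideanHalfSpace.dilate_face {t : ℝ} (ht : 0 ≤ t) (u : 𝔼 (n + 1)) :
    EuclideanHalfSpace.dilate t (EuclideanHalfSpace.face u) = EuclideanHalfSpace.face (t • u) := by
  apply EuclideanHalfSpace.ext
  rw [EuclideanHalfSpace.val_dilate_of_nonneg ht]
  ext i
  refine Fin.cases ?_ (fun j => ?_) i
  · simp
  · simp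

/-- A point of the closed half space of height `0` is the face point of its tail. [folklore] -/
theorem EuclideanHalfSpace.face_hsTail_of_apply_zero (x : ℍ (n + 2)) (hx : x.val 0 = 0) :
    EuclideanHalfSpace.face (hsTail x) = x := by
  apply EuclideanHalfSpace.ext
  ext i
  refine Fin.cases ?_ (fun j => ?_) i
  · rw [EuclideanHalfSpace.val_face_apply_zero, hx]
  · rw [EuclideanHalfSpace.val_face_apply_succ]
    rfl

/-- The flat face inclusion `ℝⁿ⁺¹ → ℝⁿ⁺²₊` is smooth (it is the tree's
`BoundaryManifold.toHalfSpace`, definitionally). [folklore] -/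
theorem EuclideanHalfSpace.contMDiff_face :
    ContMDiff (𝓡 (n + 1)) (𝓡∂ (n + 2)) ∞ (EuclideanHalfSpace.face (n := n + 1)) :=
  contMDiff_toHalfSpace

/-- The underlying vector of the face point depends isometrically on the point. [folklore] -/
theorem EuclideanHalfSpace.isometry_val_face :
    Isometry fun x' : 𝔼 (n + 1) => (EuclideanHalfSpace.face x').val := by
  refine Isometry.of_dist_eq fun x y => ?_
  rw [dist_eq_norm, dist_eq_norm, val_face_eq_consCLE, val_face_eq_consCLE, ← map_sub,
    Prod.mk_sub_mk, sub_zero, ← val_face_eq_consCLE, EuclideanHalfSpace.norm_val_face]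

/-- The flat face inclusion is a topological embedding. [folklore] -/
theorem EuclideanHalfSpace.isEmbedding_face :
    IsEmbedding (EuclideanHalfSpace.face (n := n + 1)) :=
  (IsEmbedding.subtypeVal.of_comp_iff).1 EuclideanHalfSpace.isometry_val_face.isEmbedding

end FaceLemmas

/-! ### §5 One side of the splitting: a gluing with seam-adapted witnesses -/

section SeamSide

variable (n : ℕ)

/-- **One side of Matveyev's splitting**: the data of a gluing `X = A ∪_φ B` along the boundary
(boundary data `bA`, `bB`, the identification `φ`), half-discs `kA`, `kB` with `φ`-corresponding
flat faces `fA`, `φ ∘ fA`, and *seam-adapted witnesses* `jA`, `jB` together with the smooth disc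
`i : ℝⁿ⁺² ↪ X` straddling the seam (`i = jA ∘ kA` on the upper and `i ∘ reflectZero = jB ∘ kB` on
the lower closed unit half-ball), as provided by `Literature.Topology.FourManifolds.exists_seamAdaptedWitnesses`. A bookkeeping
structure for the proof of `Literature.Topology.FourManifolds.exists_isConnectedSum_isBoundaryGluing_of_halfDiscs`. [folklore] -/
structure SeamSide (A B : Type u) (X : Type v)
    [TopologicalSpace A] [ChartedSpace (ℍ (n + 2)) A]
    [TopologicalSpace B] [ChartedSpace (ℍ (n + 2)) B]
    [TopologicalSpace X] [ChartedSpace (𝔼 (n + 2)) X] where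
  /-- boundary data of the first piece -/
  bA : BoundaryData (𝓡∂ (n + 2)) A (𝓡 (n + 1))
  /-- boundary data of the second piece -/
  bB : BoundaryData (𝓡∂ (n + 2)) B (𝓡 (n + 1))
  /-- the identification of the boundaries -/
  φ : bA.carrier ≃ₘ⟮𝓡 (n + 1), 𝓡 (n + 1)⟯ bB.carrier
  /-- the half-disc in the first piece -/
  kA : ℍ (n + 2) → A
  /-- the half-disc in the second piece -/
  kB : ℍ (n + 2) → B
  /-- the flat face of `kA` -/
  fA : 𝔼 (n + 1) → bA.carrier
  /-- the embedding of the first piece -/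
  jA : A → X
  /-- the embedding of the second piece -/
  jB : B → X
  /-- the disc straddling the seam -/
  i : 𝔼 (n + 2) → X
  hkA : Manifold.IsSmoothEmbedding (𝓡∂ (n + 2)) (𝓡∂ (n + 2)) ∞ kA
  hkAo : IsOpen (range kA)
  hkB : Manifold.IsSmoothEmbedding (𝓡∂ (n + 2)) (𝓡∂ (n + 2)) ∞ kB
  hkBo : IsOpen (range kB)
  faceA : ∀ x', kA (EuclideanHalfSpace.face x') = bA.incl (fA x')
  faceB : ∀ x', kB (EuclideanHalfSpace.face x') = bB.incl (φ (fA x'))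
  hjA : Manifold.IsSmoothEmbedding (𝓡∂ (n + 2)) (𝓡 (n + 2)) ∞ jA
  hjB : Manifold.IsSmoothEmbedding (𝓡∂ (n + 2)) (𝓡 (n + 2)) ∞ jB
  cover : range jA ∪ range jB = univ
  rel : ∀ a b, jA a = jB b ↔ ∃ z, a = bA.incl z ∧ b = bB.incl (φ z)
  hi : Manifold.IsSmoothEmbedding 𝓘(ℝ, 𝔼 (n + 2)) (𝓡 (n + 2)) ∞ i
  hio : IsOpen (range i)
  i_upper : ∀ x : ℍ (n + 2), ‖x.val‖ ≤ 1 → i x.val = jA (kA x)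
  i_lower : ∀ x : ℍ (n + 2), ‖x.val‖ ≤ 1 → i (reflectZero x.val) = jB (kB x)

namespace SeamSide

variable {n} {A B : Type u} {X : Type v}
    [TopologicalSpace A] [ChartedSpace (ℍ (n + 2)) A]
    [TopologicalSpace B] [ChartedSpace (ℍ (n + 2)) B]
    [TopologicalSpace X] [ChartedSpace (𝔼 (n + 2)) X]
    (G : SeamSide n A B X)

/-- `jA` is injective. [folklore] -/
theorem jA_injective : Injective G.jA := G.hjA.isEmbedding.injective

/-- `jB` is injective. [folklore] -/
theorem jB_injective : Injective G.jB := G.hjB.isEmbedding.injective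

/-- `kA` is injective. [folklore] -/
theorem kA_injective : Injective G.kA := G.hkA.isEmbedding.injective

/-- `kB` is injective. [folklore] -/
theorem kB_injective : Injective G.kB := G.hkB.isEmbedding.injective

/-- The straddling disc is injective. [folklore] -/
theorem i_injective : Injective G.i := G.hi.isEmbedding.injective

/-- The centre of the half-disc `kA` is the boundary point `fA 0`. [folklore] -/
theorem kA_zero : G.kA 0 = G.bA.incl (G.fA 0) := by
  rw [← EuclideanHalfSpace.face_zero, G.faceA]

/-- The centre of the half-disc `kB` is the boundary point `φ (fA 0)`. [folklore] -/
theorem kB_zero : G.kB 0 = G.bB.incl (G.φ (G.fA 0)) := by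
  rw [← EuclideanHalfSpace.face_zero, G.faceB]

/-- The centre of the disc `i` is the seam point `jA (kA 0)`. [folklore] -/
theorem i_zero : G.i 0 = G.jA (G.kA 0) := by
  have h := G.i_upper 0 (by change ‖(0 : 𝔼 (n + 2))‖ ≤ 1; simp)
  exact h

/-- The centre of the disc `i` is also `jB (kB 0)`. [folklore] -/
theorem i_zero' : G.i 0 = G.jB (G.kB 0) := by
  have h := G.i_lower 0 (by change ‖(0 : 𝔼 (n + 2))‖ ≤ 1; simp)
  have h0 : (0 : ℍ (n + 2)).val = 0 := rfl
  rw [h0, reflectZero_zero] at h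
  exact h

/-- The half-disc `kA` meets `∂A` exactly along its flat face. [folklore] -/
theorem kA_mem_range_incl_iff (x : ℍ (n + 2)) : G.kA x ∈ range G.bA.incl ↔ x.val 0 = 0 := by
  rw [G.bA.range_incl, halfDisc_mem_boundary_iff G.hkA G.hkAo]

/-- The half-disc `kB` meets `∂B` exactly along its flat face. [folklore] -/
theorem kB_mem_range_incl_iff (x : ℍ (n + 2)) : G.kB x ∈ range G.bB.incl ↔ x.val 0 = 0 := by
  rw [G.bB.range_incl, halfDisc_mem_boundary_iff G.hkB G.hkBo]

/-- Points of `A` and `B` with the same image in `X` are boundary points. [folklore] -/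
theorem mem_range_incl_of_jA_eq_jB {a : A} {b : B} (h : G.jA a = G.jB b) :
    a ∈ range G.bA.incl ∧ b ∈ range G.bB.incl := by
  obtain ⟨z, rfl, rfl⟩ := (G.rel a b).1 h
  exact ⟨⟨z, rfl⟩, ⟨_, rfl⟩⟩

/-- A point of the closed half space of height `0`, written as a face point: `kA x = incl (fA x')`
with `x = face x'`. [folklore] -/
theorem kA_eq_incl_fA_of_apply_zero (x : ℍ (n + 2)) (hx : x.val 0 = 0) :
    G.kA x = G.bA.incl (G.fA (hsTail x)) := by
  rw [← G.faceA, EuclideanHalfSpace.face_hsTail_of_apply_zero x hx]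

/-- A point of height `0` under `kB`: `kB x = incl (φ (fA x'))`. [folklore] -/
theorem kB_eq_incl_fA_of_apply_zero (x : ℍ (n + 2)) (hx : x.val 0 = 0) :
    G.kB x = G.bB.incl (G.φ (G.fA (hsTail x))) := by
  rw [← G.faceB, EuclideanHalfSpace.face_hsTail_of_apply_zero x hx]

/-! #### The disc `i` on rays -/

/-- The closed half-space point `t • u` for a vector `u` of nonnegative height and `t ≥ 0`. [folklore] -/
def ray (u : 𝔼 (n + 2)) (hu : 0 ≤ u 0) (t : ℝ) (ht : 0 ≤ t) : ℍ (n + 2) :=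
  ⟨t • u, by simpa using mul_nonneg ht hu⟩

/-- The underlying vector of `ray u t` is `t • u`. [folklore] -/
@[simp] theorem ray_val (u : 𝔼 (n + 2)) (hu : 0 ≤ u 0) (t : ℝ) (ht : 0 ≤ t) :
    (ray u hu t ht).val = t • u := rfl

/-- `ray u t = dilate t u`. [folklore] -/
theorem ray_eq_dilate (u : 𝔼 (n + 2)) (hu : 0 ≤ u 0) (t : ℝ) (ht : 0 ≤ t) :
    ray u hu t ht = EuclideanHalfSpace.dilate t ⟨u, by simpa using hu⟩ := by
  apply EuclideanHalfSpace.ext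
  rw [ray_val, EuclideanHalfSpace.val_dilate_of_nonneg ht]

variable {G}

/-- **The disc `i` on the upper half-ball is `jA ∘ kA`**: for a unit vector `u` of nonnegative
height and `0 ≤ t ≤ 1`, `i (t • u) = jA (kA (t • u))`. [folklore] -/
theorem i_smul_of_nonneg {u : 𝔼 (n + 2)} (hu : ‖u‖ = 1) (h0 : 0 ≤ u 0) {t : ℝ}
    (ht0 : 0 ≤ t) (ht1 : t ≤ 1) : G.i (t • u) = G.jA (G.kA (ray u h0 t ht0)) := by
  have h := G.i_upper (ray u h0 t ht0) (by
    rw [ray_val, norm_smul, hu, mul_one, Real.norm_of_nonneg ht0]; exact ht1)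
  simpa using h

/-- **The disc `i` on the lower half-ball is `jB ∘ kB ∘ reflectZero`**: for a unit vector `u` of
nonpositive height and `0 ≤ t ≤ 1`, `i (t • u) = jB (kB (t • ū))`, `ū = reflectZero u`. [folklore] -/
theorem i_smul_of_nonpos {u : 𝔼 (n + 2)} (hu : ‖u‖ = 1) (h0 : u 0 ≤ 0) {t : ℝ}
    (ht0 : 0 ≤ t) (ht1 : t ≤ 1) :
    G.i (t • u) = G.jB (G.kB (ray (reflectZero u) (reflectZero_mem_halfSpace h0) t ht0)) := by
  have h := G.i_lower (ray (reflectZero u) (reflectZero_mem_halfSpace h0) t ht0) (by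
    rw [ray_val, norm_smul, norm_reflectZero, hu, mul_one, Real.norm_of_nonneg ht0]; exact ht1)
  rw [ray_val, ← reflectZero_smul, reflectZero_reflectZero] at h
  exact h

/-- A point `i (t • u)` (`‖u‖ = 1`, `0 < t ≤ 1`) lying in `jA (A)` has `u` of nonnegative
height. [folklore] -/
theorem nonneg_of_i_smul_eq_jA {u : 𝔼 (n + 2)} (hu : ‖u‖ = 1) {t : ℝ} (ht0 : 0 < t) (ht1 : t ≤ 1)
    {a : A} (h : G.i (t • u) = G.jA a) : 0 ≤ u 0 := by
  by_contra hneg'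
  have hneg : u 0 < 0 := lt_of_not_ge hneg'
  rw [i_smul_of_nonpos hu hneg.le ht0.le ht1] at h
  have hb := (G.mem_range_incl_of_jA_eq_jB h.symm).2
  rw [G.kB_mem_range_incl_iff, ray_val] at hb
  have : t * (reflectZero u) 0 = 0 := by simpa using hb
  rw [reflectZero_apply_zero, mul_neg, neg_eq_zero, mul_eq_zero] at this
  rcases this with h1 | h1
  · exact ht0.ne' h1
  · exact hneg.ne h1

/-- A point `i (t • u)` (`‖u‖ = 1`, `0 < t ≤ 1`) lying in `jB (B)` has `u` of nonpositive
height. [folklore] -/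
theorem nonpos_of_i_smul_eq_jB {u : 𝔼 (n + 2)} (hu : ‖u‖ = 1) {t : ℝ} (ht0 : 0 < t) (ht1 : t ≤ 1)
    {b : B} (h : G.i (t • u) = G.jB b) : u 0 ≤ 0 := by
  by_contra hpos'
  have hpos : 0 < u 0 := lt_of_not_ge hpos'
  rw [i_smul_of_nonneg hu hpos.le ht0.le ht1] at h
  have ha := (G.mem_range_incl_of_jA_eq_jB h).1
  rw [G.kA_mem_range_incl_iff, ray_val] at ha
  have : t * u 0 = 0 := by simpa using ha
  rcases mul_eq_zero.1 this with h1 | h1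
  · exact ht0.ne' h1
  · exact hpos.ne' h1

variable (G)

/-- **The punctured `X` is covered by the punctured pieces**: a point `x ≠ i 0` of `X` is
`jA a` with `a ≠ kA 0` or `jB b` with `b ≠ kB 0`. [folklore] -/
theorem exists_eq_of_ne_i_zero {x : X} (hx : x ≠ G.i 0) :
    (∃ a, a ≠ G.kA 0 ∧ G.jA a = x) ∨ ∃ b, b ≠ G.kB 0 ∧ G.jB b = x := by
  have hx' : x ∈ range G.jA ∪ range G.jB := by rw [G.cover]; exact mem_univ x
  rcases hx' with ⟨a, rfl⟩ | ⟨b, rfl⟩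
  · refine Or.inl ⟨a, fun h => hx ?_, rfl⟩
    rw [h, G.i_zero]
  · refine Or.inr ⟨b, fun h => hx ?_, rfl⟩
    rw [h, G.i_zero']

/-! #### The flat face map is a smooth open embedding -/

/-- `incl ∘ fA = kA ∘ face`. [folklore] -/
theorem incl_comp_fA : G.bA.incl ∘ G.fA = G.kA ∘ EuclideanHalfSpace.face :=
  funext fun x' => (G.faceA x').symm

/-- The face map is injective. [folklore] -/
theorem fA_injective : Injective G.fA := by
  intro x y h
  have : G.kA (EuclideanHalfSpace.face x) = G.kA (EuclideanHalfSpace.face y) := by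
    rw [G.faceA, G.faceA, h]
  exact EuclideanHalfSpace.face_injective (G.kA_injective this)

/-- The face map is continuous. [folklore] -/
theorem continuous_fA : Continuous G.fA := by
  rw [G.bA.isSmoothEmbedding.isEmbedding.continuous_iff, incl_comp_fA]
  exact G.hkA.contMDiff.continuous.comp EuclideanHalfSpace.continuous_face

/-- The face map is a topological embedding. [folklore] -/
theorem isEmbedding_fA : IsEmbedding G.fA := by
  rw [← G.bA.isSmoothEmbedding.isEmbedding.of_comp_iff, incl_comp_fA]
  exact G.hkA.isEmbedding.comp EuclideanHalfSpace.isEmbedding_face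

/-- The range of the face map is the trace of the half-disc on the boundary:
`range fA = incl ⁻¹' (range kA)`. [folklore] -/
theorem range_fA : range G.fA = G.bA.incl ⁻¹' range G.kA := by
  ext z
  constructor
  · rintro ⟨x', rfl⟩
    exact ⟨EuclideanHalfSpace.face x', G.faceA x'⟩
  · rintro ⟨x, hx⟩
    have h0 : x.val 0 = 0 := (G.kA_mem_range_incl_iff x).1 ⟨z, hx.symm⟩
    rw [G.kA_eq_incl_fA_of_apply_zero x h0] at hx
    exact ⟨hsTail x, G.bA.injective_incl hx⟩

/-- The face map has open range in `∂A`. [folklore] -/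
theorem isOpen_range_fA : IsOpen (range G.fA) := by
  rw [range_fA]
  exact G.hkAo.preimage G.bA.continuous_incl

/-- The face map `fA : ℝⁿ⁺¹ → ∂A` is smooth: `fA = incl⁻¹ ∘ kA ∘ face` with `incl⁻¹` smooth on
`∂A = range incl`. [folklore] -/
theorem contMDiff_fA : ContMDiff (𝓡 (n + 1)) (𝓡 (n + 1)) ∞ G.fA := by
  haveI : Nonempty G.bA.carrier := ⟨G.fA 0⟩
  set g := Function.invFun G.bA.incl
  have hg : LeftInverse g G.bA.incl := Function.leftInverse_invFun G.bA.injective_incl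
  have hgs : ContMDiffOn (𝓡∂ (n + 2)) (𝓡 (n + 1)) ∞ g (range G.bA.incl) :=
    contMDiffOn_leftInverse_of_isImmersion G.bA.isSmoothEmbedding.isImmersion
      G.bA.isSmoothEmbedding.isEmbedding hg
  have heq : G.fA = g ∘ (G.kA ∘ EuclideanHalfSpace.face) := by
    funext x'; simp only [comp_apply, G.faceA, hg (G.fA x')]
  rw [heq]
  refine hgs.comp_contMDiff (G.hkA.contMDiff.comp EuclideanHalfSpace.contMDiff_face) fun x' => ?_
  exact ⟨G.fA x', (G.faceA x').symm⟩

/-- A smooth left inverse of `fA` on its range: `hsTail ∘ kA⁻¹ ∘ incl`. [folklore] -/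
theorem contMDiffOn_leftInverse_fA :
    ∃ g : G.bA.carrier → 𝔼 (n + 1), LeftInverse g G.fA ∧
      ContMDiffOn (𝓡 (n + 1)) (𝓡 (n + 1)) ∞ g (range G.fA) := by
  set kinv := Function.invFun G.kA
  have hk : LeftInverse kinv G.kA := Function.leftInverse_invFun G.kA_injective
  have hks : ContMDiffOn (𝓡∂ (n + 2)) (𝓡∂ (n + 2)) ∞ kinv (range G.kA) :=
    contMDiffOn_leftInverse_of_isImmersion G.hkA.isImmersion G.hkA.isEmbedding hk
  refine ⟨hsTail ∘ kinv ∘ G.bA.incl, fun x' => ?_, ?_⟩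
  · simp only [comp_apply, ← G.faceA, hk _, hsTail_face]
  · refine contMDiff_hsTail.comp_contMDiffOn (hks.comp G.bA.isSmoothEmbedding.contMDiff.contMDiffOn ?_)
    rw [range_fA]

/-- **The flat face map is a smooth embedding** `ℝⁿ⁺¹ ↪ ∂A` (with open range). [folklore] -/
theorem isSmoothEmbedding_fA : Manifold.IsSmoothEmbedding 𝓘(ℝ, 𝔼 (n + 1)) (𝓡 (n + 1)) ∞ G.fA := by
  have ho : IsOpenEmbedding G.fA := ⟨G.isEmbedding_fA, G.isOpen_range_fA⟩
  obtain ⟨g, hg, hgs⟩ := G.contMDiffOn_leftInverse_fA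
  set Φ := ho.toOpenPartialHomeomorph G.fA
  have hΦs : ContMDiffOn 𝓘(ℝ, 𝔼 (n + 1)) (𝓡 (n + 1)) ∞ Φ Φ.source := G.contMDiff_fA.contMDiffOn
  have hΦ's : ContMDiffOn (𝓡 (n + 1)) 𝓘(ℝ, 𝔼 (n + 1)) ∞ Φ.symm Φ.target := by
    have ht : Φ.target = range G.fA := ho.toOpenPartialHomeomorph_target
    rw [ht]
    refine hgs.congr ?_
    rintro _ ⟨x', rfl⟩
    have h1 : Φ.symm (G.fA x') = x' := ho.toOpenPartialHomeomorph_left_inv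
    rw [h1, hg x']
  exact isSmoothEmbedding_of_openPartialHomeomorph Φ ho.toOpenPartialHomeomorph_source hΦs hΦ's
    (ContinuousLinearEquiv.refl ℝ _)

end SeamSide

end SeamSide

/-! ### §6 Connected sum data: the glued manifold of a `ConnectedSumData` -/

namespace ConnectedSumData

variable {m : ℕ} {M : Type u} {N : Type v}
  [TopologicalSpace M] [T2Space M] [ChartedSpace (𝔼 m) M]
  [TopologicalSpace N] [T2Space N] [ChartedSpace (𝔼 m) N]
  (D : ConnectedSumData m M N) (hm : m ≠ 0)

/-- The identification in the glued manifold is Kervaire–Milnor's relation. [cite: KervaireMilnor1963, §2] -/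
theorem inl_eq_inr_iff_connectedSumRel (a : D.A) (b : D.B) :
    (D.glueData hm).inl a = (D.glueData hm).inr b ↔ connectedSumRel D.i₁ D.i₂ a b := by
  rw [(D.glueData hm).inl_eq_inr_iff, glueData_glue, D.connectedSumRel_iff_φ hm]

/-- `M # N` is Hausdorff (instance form of `ConnectedSumData.t2Space_glued`). [cite: Kosinski1993, Ch. VI §1, Thm (1.1)] -/
instance instT2SpaceGlued : T2Space (D.Glued hm) := D.t2Space_glued hm

/-- `M # N` of compact pieces is compact (instance form of `ConnectedSumData.compactSpace_glued`). [cite: KervaireMilnor1963, §2] -/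
instance instCompactSpaceGlued [CompactSpace M] [CompactSpace N] : CompactSpace (D.Glued hm) :=
  D.compactSpace_glued hm

/-- `M # N` of compact pieces is second countable (instance form). [folklore] -/
instance instSecondCountableTopologyGlued [IsManifold (𝓡 m) ∞ M] [IsManifold (𝓡 m) ∞ N]
    [CompactSpace M] [CompactSpace N] : SecondCountableTopology (D.Glued hm) :=
  D.secondCountableTopology_glued hm

/-- The glued manifold of a connected sum datum is a connected sum along its discs. [cite: Kosinski1993, Ch. VI §1, Thm (1.1)] -/
theorem isConnectedSum_glued [IsManifold (𝓡 m) ∞ M] [IsManifold (𝓡 m) ∞ N] :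
    IsConnectedSum (𝓡 m) (𝓡 m) (𝓡 m) M N (D.glueData hm).Glued :=
  ⟨D.i₁, D.i₂, D.isSmoothEmbedding_i₁, D.isSmoothEmbedding_i₂,
    (D.glueData hm).isOpenGluing (D.connectedSumRel_iff_φ hm)⟩

omit [T2Space M] [T2Space N] in
/-- **Connected sum data from a prescribed first disc**: a smooth embedding `i : ℝᵐ → M` with open
range is the inverse of a chart of the maximal atlas with full target. [folklore] -/
theorem exists_of_isSmoothEmbedding [IsManifold (𝓡 m) ∞ M] {i : 𝔼 m → M}
    (hi : Manifold.IsSmoothEmbedding 𝓘(ℝ, 𝔼 m) (𝓡 m) ∞ i) :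
    ∃ e : OpenPartialHomeomorph M (𝔼 m), e ∈ IsManifold.maximalAtlas (𝓡 m) ∞ M ∧
      e.target = univ ∧ ⇑e.symm = i := by
  obtain ⟨Φ, ht, hsymm, hsrc, hΦ⟩ := exists_chart_of_isSmoothEmbedding hi
  refine ⟨Φ, Φ.mem_maximalAtlas_of_contMDiffOn hΦ ?_, ht, hsymm⟩
  rw [ht, hsymm]
  exact hi.contMDiff.contMDiffOn

end ConnectedSumData

/-! ### §7 Half gluings and the glued map of the pieces -/

section HalfGluing

variable {m : ℕ} [NeZero m]

/-- **An open gluing along Juhász's relation, unpacked**: the witnesses `ι₁`, `ι₂` of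
`IsOpenGluing … (boundaryConnectedSumRel k₁ k₂)` (`P = A' ♮ C'` along the half-discs `k₁`, `k₂`).
[cite: Juhasz2023, Def. 1.47] -/
structure HalfGluing {A' C' : Type u} [TopologicalSpace A'] [T1Space A'] [ChartedSpace (ℍ m) A']
    [TopologicalSpace C'] [T1Space C'] [ChartedSpace (ℍ m) C']
    (k₁ : ℍ m → A') (k₂ : ℍ m → C') (P : Type u) [TopologicalSpace P] [ChartedSpace (ℍ m) P] where
  /-- the embedding of the first punctured piece -/
  ι₁ : ↥(puncture k₁) → P
  /-- the embedding of the second punctured piece -/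
  ι₂ : ↥(puncture k₂) → P
  h₁ : Manifold.IsSmoothEmbedding (𝓡∂ m) (𝓡∂ m) ∞ ι₁
  h₁o : IsOpen (range ι₁)
  h₂ : Manifold.IsSmoothEmbedding (𝓡∂ m) (𝓡∂ m) ∞ ι₂
  h₂o : IsOpen (range ι₂)
  cover : range ι₁ ∪ range ι₂ = univ
  rel : ∀ a c, ι₁ a = ι₂ c ↔ boundaryConnectedSumRel k₁ k₂ a c

variable {A' C' : Type u} [TopologicalSpace A'] [T1Space A'] [ChartedSpace (ℍ m) A']
    [TopologicalSpace C'] [T1Space C'] [ChartedSpace (ℍ m) C']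
    {k₁ : ℍ m → A'} {k₂ : ℍ m → C'} {P : Type u} [TopologicalSpace P] [ChartedSpace (ℍ m) P]

/-- Unpacking an open gluing along Juhász's relation. [cite: Juhasz2023, Def. 1.47] -/
theorem HalfGluing.nonempty_of_isOpenGluing
    (h : IsOpenGluing (𝓡∂ m) (𝓡∂ m) (𝓡∂ m) (A := ↥(puncture k₁)) (B := ↥(puncture k₂)) (P := P)
      (boundaryConnectedSumRel k₁ k₂)) : Nonempty (HalfGluing k₁ k₂ P) := by
  obtain ⟨ι₁, ι₂, h₁, h₁o, h₂, h₂o, hc, hr⟩ := h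
  exact ⟨⟨ι₁, ι₂, h₁, h₁o, h₂, h₂o, hc, hr⟩⟩

namespace HalfGluing

variable (W : HalfGluing k₁ k₂ P)

/-- `ι₁` is injective. [folklore] -/
theorem ι₁_injective : Injective W.ι₁ := W.h₁.isEmbedding.injective

/-- `ι₂` is injective. [folklore] -/
theorem ι₂_injective : Injective W.ι₂ := W.h₂.isEmbedding.injective

/-- Every point of `P` comes from one of the pieces. [cite: Juhasz2023, Def. 1.47] -/
theorem exists_eq (p : P) : (∃ a, W.ι₁ a = p) ∨ ∃ c, W.ι₂ c = p := by
  have : p ∈ range W.ι₁ ∪ range W.ι₂ := by rw [W.cover]; exact mem_univ p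
  exact this

section ChartOne

variable [Nonempty ↥(puncture k₁)]

/-- The first embedding as an open partial homeomorphism. [folklore] -/
def chart₁ : OpenPartialHomeomorph ↥(puncture k₁) P := openEmbeddingChart W.h₁ W.h₁o

/-- `chart₁⁻¹ ∘ ι₁ = id`. [folklore] -/
@[simp] theorem chart₁_symm_apply (a : ↥(puncture k₁)) : W.chart₁.symm (W.ι₁ a) = a :=
  openEmbeddingChart_symm_apply _ _ a

/-- `ι₁ ∘ chart₁⁻¹ = id` on the range. [folklore] -/
theorem ι₁_chart₁_symm {p : P} (hp : p ∈ range W.ι₁) : W.ι₁ (W.chart₁.symm p) = p :=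
  apply_openEmbeddingChart_symm _ _ hp

/-- `chart₁⁻¹` is smooth on the range of `ι₁`. [folklore] -/
theorem contMDiffOn_chart₁_symm : ContMDiffOn (𝓡∂ m) (𝓡∂ m) ∞ W.chart₁.symm (range W.ι₁) := by
  simpa [chart₁] using contMDiffOn_openEmbeddingChart_symm W.h₁ W.h₁o

end ChartOne

section ChartTwo

variable [Nonempty ↥(puncture k₂)]

/-- The second embedding as an open partial homeomorphism. [folklore] -/
def chart₂ : OpenPartialHomeomorph ↥(puncture k₂) P := openEmbeddingChart W.h₂ W.h₂o

/-- `chart₂⁻¹ ∘ ι₂ = id`. [folklore] -/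
@[simp] theorem chart₂_symm_apply (c : ↥(puncture k₂)) : W.chart₂.symm (W.ι₂ c) = c :=
  openEmbeddingChart_symm_apply _ _ c

/-- `ι₂ ∘ chart₂⁻¹ = id` on the range. [folklore] -/
theorem ι₂_chart₂_symm {p : P} (hp : p ∈ range W.ι₂) : W.ι₂ (W.chart₂.symm p) = p :=
  apply_openEmbeddingChart_symm _ _ hp

/-- `chart₂⁻¹` is smooth on the range of `ι₂`. [folklore] -/
theorem contMDiffOn_chart₂_symm : ContMDiffOn (𝓡∂ m) (𝓡∂ m) ∞ W.chart₂.symm (range W.ι₂) := by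
  simpa [chart₂] using contMDiffOn_openEmbeddingChart_symm W.h₂ W.h₂o

end ChartTwo

end HalfGluing

end HalfGluing

section GlueMap

variable {m : ℕ} [NeZero m] {X : Type u} {S : Type v}
  [TopologicalSpace X] [T2Space X] [ChartedSpace (𝔼 m) X]
  [TopologicalSpace S] [T2Space S] [ChartedSpace (𝔼 m) S]
  {A' C' : Type u} [TopologicalSpace A'] [T2Space A'] [ChartedSpace (ℍ m) A']
  [TopologicalSpace C'] [T2Space C'] [ChartedSpace (ℍ m) C']

/-- **The embeddings of two pieces into the two summands of a connected sum, compatible with the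
half-discs**: `j₁ : A' → X`, `j₂ : C' → S` smooth embeddings sending the centres of the half-discs
`k₁`, `k₂` to the centres of the discs `i₁`, `i₂` of the connected sum datum `D`, and such that
Juhász's relation along `k₁, k₂` corresponds to Kervaire–Milnor's along `i₁, i₂`. (For Matveyev's
fig. 2: `(j₁, j₂) = (jA, jC)` for the pieces `A ♮ C`, `= (jB, jD)` for `B ♮ D`.) [folklore] -/
structure PieceMaps (D : ConnectedSumData m X S) (k₁ : ℍ m → A') (k₂ : ℍ m → C') where
  /-- the embedding of the first piece into the first summand -/
  j₁ : A' → X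
  /-- the embedding of the second piece into the second summand -/
  j₂ : C' → S
  hj₁ : Manifold.IsSmoothEmbedding (𝓡∂ m) (𝓡 m) ∞ j₁
  hj₂ : Manifold.IsSmoothEmbedding (𝓡∂ m) (𝓡 m) ∞ j₂
  centre₁ : j₁ (k₁ 0) = D.i₁ 0
  centre₂ : j₂ (k₂ 0) = D.i₂ 0
  compat : ∀ (a : A') (c : C'),
    (∃ (v : ℍ m) (t : ℝ), ‖v.val‖ = 1 ∧ t ∈ Ioo (0 : ℝ) 1 ∧
        a = k₁ (EuclideanHalfSpace.dilate t v) ∧ c = k₂ (EuclideanHalfSpace.dilate (1 - t) v)) ↔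
      ∃ (u : 𝔼 m) (t : ℝ), ‖u‖ = 1 ∧ t ∈ Ioo (0 : ℝ) 1 ∧
        j₁ a = D.i₁ (t • u) ∧ j₂ c = D.i₂ ((1 - t) • u)

namespace PieceMaps

variable {D : ConnectedSumData m X S} {k₁ : ℍ m → A'} {k₂ : ℍ m → C'} (J : PieceMaps D k₁ k₂)

omit [T2Space S] [T2Space C'] in
/-- `j₁` maps the punctured piece into the punctured summand. [folklore] -/
theorem j₁_mem (a : ↥(puncture k₁)) : J.j₁ a.val ∈ puncture D.i₁ := by
  rw [mem_puncture, ← J.centre₁]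
  exact fun h => a.2 (J.hj₁.isEmbedding.injective h)

omit [T2Space X] [T2Space A'] in
/-- `j₂` maps the punctured piece into the punctured summand. [folklore] -/
theorem j₂_mem (c : ↥(puncture k₂)) : J.j₂ c.val ∈ puncture D.i₂ := by
  rw [mem_puncture, ← J.centre₂]
  exact fun h => c.2 (J.hj₂.isEmbedding.injective h)

/-- The first piece map on the punctured pieces. [folklore] -/
def lift₁ (a : ↥(puncture k₁)) : D.A := ⟨J.j₁ a.val, J.j₁_mem a⟩

/-- The second piece map on the punctured pieces. [folklore] -/
def lift₂ (c : ↥(puncture k₂)) : D.B := ⟨J.j₂ c.val, J.j₂_mem c⟩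

omit [T2Space S] [T2Space C'] in
/-- Underlying point of `lift₁`. [folklore] -/
@[simp] theorem lift₁_val (a : ↥(puncture k₁)) : (J.lift₁ a).val = J.j₁ a.val := rfl

omit [T2Space X] [T2Space A'] in
/-- Underlying point of `lift₂`. [folklore] -/
@[simp] theorem lift₂_val (c : ↥(puncture k₂)) : (J.lift₂ c).val = J.j₂ c.val := rfl

omit [T2Space S] [T2Space C'] in
/-- `lift₁` is injective. [folklore] -/
theorem lift₁_injective : Injective J.lift₁ := fun _ _ h =>
  Subtype.ext (J.hj₁.isEmbedding.injective (congrArg Subtype.val h))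

omit [T2Space X] [T2Space A'] in
/-- `lift₂` is injective. [folklore] -/
theorem lift₂_injective : Injective J.lift₂ := fun _ _ h =>
  Subtype.ext (J.hj₂.isEmbedding.injective (congrArg Subtype.val h))

omit [T2Space S] [T2Space C'] in
/-- `lift₁` is smooth. [folklore] -/
theorem contMDiff_lift₁ : ContMDiff (𝓡∂ m) (𝓡 m) ∞ J.lift₁ :=
  (ContMDiff.subtypeVal_comp_iff _ _).1 (J.hj₁.contMDiff.comp contMDiff_subtype_val)

omit [T2Space X] [T2Space A'] in
/-- `lift₂` is smooth. [folklore] -/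
theorem contMDiff_lift₂ : ContMDiff (𝓡∂ m) (𝓡 m) ∞ J.lift₂ :=
  (ContMDiff.subtypeVal_comp_iff _ _).1 (J.hj₂.contMDiff.comp contMDiff_subtype_val)

variable (hm : m ≠ 0)

/-- **The two relations correspond**: `inl (j₁ a) = inr (j₂ c)` in `X # S` iff `a ∼ c` along
Juhász's relation. [folklore] -/
theorem inl_lift₁_eq_inr_lift₂_iff (a : ↥(puncture k₁)) (c : ↥(puncture k₂)) :
    (D.glueData hm).inl (J.lift₁ a) = (D.glueData hm).inr (J.lift₂ c) ↔
      boundaryConnectedSumRel k₁ k₂ a c := by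
  rw [D.inl_eq_inr_iff_connectedSumRel hm]
  exact (J.compat a.val c.val).symm

variable {P : Type u} [TopologicalSpace P] [ChartedSpace (ℍ m) P]
  (W : HalfGluing k₁ k₂ P) [Nonempty ↥(puncture k₁)] [Nonempty ↥(puncture k₂)]

/-- **The glued map** `P = A' ♮ C' → X # S`: `ι₁ a ↦ inl (j₁ a)`, `ι₂ c ↦ inr (j₂ c)`. [folklore] -/
def glueMap (p : P) : (D.glueData hm).Glued := by
  classical
  exact if p ∈ range W.ι₁ then (D.glueData hm).inl (J.lift₁ (W.chart₁.symm p))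
    else (D.glueData hm).inr (J.lift₂ (W.chart₂.symm p))

/-- The glued map on the range of `ι₁` (definitional unfolding). [folklore] -/
theorem glueMap_of_mem {p : P} (hp : p ∈ range W.ι₁) :
    J.glueMap hm W p = (D.glueData hm).inl (J.lift₁ (W.chart₁.symm p)) := by
  classical
  exact if_pos hp

/-- The glued map on the first piece: `ι₁ a ↦ inl (j₁ a)`. [folklore] -/
@[simp] theorem glueMap_ι₁ (a : ↥(puncture k₁)) :
    J.glueMap hm W (W.ι₁ a) = (D.glueData hm).inl (J.lift₁ a) := by
  rw [J.glueMap_of_mem hm W ⟨a, rfl⟩, W.chart₁_symm_apply]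

/-- The glued map on the second piece: `ι₂ c ↦ inr (j₂ c)` (well defined because the two relations correspond). [folklore] -/
@[simp] theorem glueMap_ι₂ (c : ↥(puncture k₂)) :
    J.glueMap hm W (W.ι₂ c) = (D.glueData hm).inr (J.lift₂ c) := by
  classical
  by_cases h : W.ι₂ c ∈ range W.ι₁
  · obtain ⟨a, ha⟩ := h
    rw [← ha, J.glueMap_ι₁, J.inl_lift₁_eq_inr_lift₂_iff]
    exact (W.rel a c).1 ha
  · change (if W.ι₂ c ∈ range W.ι₁ then _ else _) = _
    rw [if_neg h, W.chart₂_symm_apply]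

/-- The glued map on the range of `ι₁` is `inl ∘ lift₁ ∘ chart₁⁻¹`. [folklore] -/
theorem glueMap_eqOn_range₁ :
    EqOn (J.glueMap hm W) ((D.glueData hm).inl ∘ J.lift₁ ∘ W.chart₁.symm) (range W.ι₁) := by
  rintro _ ⟨a, rfl⟩
  simp

/-- The glued map on the range of `ι₂` is `inr ∘ lift₂ ∘ chart₂⁻¹`. [folklore] -/
theorem glueMap_eqOn_range₂ :
    EqOn (J.glueMap hm W) ((D.glueData hm).inr ∘ J.lift₂ ∘ W.chart₂.symm) (range W.ι₂) := by
  rintro _ ⟨c, rfl⟩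
  simp

/-- The glued map is injective. [folklore] -/
theorem glueMap_injective : Injective (J.glueMap hm W) := by
  intro p q hpq
  rcases W.exists_eq p with ⟨a, rfl⟩ | ⟨c, rfl⟩ <;> rcases W.exists_eq q with ⟨a', rfl⟩ | ⟨c', rfl⟩
  · rw [J.glueMap_ι₁, J.glueMap_ι₁] at hpq
    rw [J.lift₁_injective ((D.glueData hm).inl_injective hpq)]
  · rw [J.glueMap_ι₁, J.glueMap_ι₂, J.inl_lift₁_eq_inr_lift₂_iff] at hpq
    exact (W.rel a c').2 hpq
  · rw [J.glueMap_ι₂, J.glueMap_ι₁, eq_comm, J.inl_lift₁_eq_inr_lift₂_iff] at hpq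
    exact ((W.rel a' c).2 hpq).symm
  · rw [J.glueMap_ι₂, J.glueMap_ι₂] at hpq
    rw [J.lift₂_injective ((D.glueData hm).inr_injective hpq)]

/-- The range of the glued map. [folklore] -/
theorem range_glueMap : range (J.glueMap hm W) =
    (D.glueData hm).inl '' range J.lift₁ ∪ (D.glueData hm).inr '' range J.lift₂ := by
  ext y
  constructor
  · rintro ⟨p, rfl⟩
    rcases W.exists_eq p with ⟨a, rfl⟩ | ⟨c, rfl⟩
    · exact Or.inl ⟨J.lift₁ a, ⟨a, rfl⟩, (J.glueMap_ι₁ hm W a).symm⟩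
    · exact Or.inr ⟨J.lift₂ c, ⟨c, rfl⟩, (J.glueMap_ι₂ hm W c).symm⟩
  · rintro (⟨_, ⟨a, rfl⟩, rfl⟩ | ⟨_, ⟨c, rfl⟩, rfl⟩)
    · exact ⟨W.ι₁ a, J.glueMap_ι₁ hm W a⟩
    · exact ⟨W.ι₂ c, J.glueMap_ι₂ hm W c⟩

variable [IsManifold (𝓡 m) ∞ X] [IsManifold (𝓡 m) ∞ S]

/-- The glued map is smooth. [folklore] -/
theorem contMDiff_glueMap : ContMDiff (𝓡∂ m) (𝓡 m) ∞ (J.glueMap hm W) := by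
  intro p
  rcases W.exists_eq p with ⟨a, rfl⟩ | ⟨c, rfl⟩
  · have hs : ContMDiffOn (𝓡∂ m) (𝓡 m) ∞ ((D.glueData hm).inl ∘ J.lift₁ ∘ W.chart₁.symm)
        (range W.ι₁) :=
      (D.glueData hm).contMDiff_inl.comp_contMDiffOn
        (J.contMDiff_lift₁.comp_contMDiffOn W.contMDiffOn_chart₁_symm)
    exact (hs.congr (J.glueMap_eqOn_range₁ hm W)).contMDiffAt (W.h₁o.mem_nhds ⟨a, rfl⟩)
  · have hs : ContMDiffOn (𝓡∂ m) (𝓡 m) ∞ ((D.glueData hm).inr ∘ J.lift₂ ∘ W.chart₂.symm)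
        (range W.ι₂) :=
      (D.glueData hm).contMDiff_inr.comp_contMDiffOn
        (J.contMDiff_lift₂.comp_contMDiffOn W.contMDiffOn_chart₂_symm)
    exact (hs.congr (J.glueMap_eqOn_range₂ hm W)).contMDiffAt (W.h₂o.mem_nhds ⟨c, rfl⟩)

variable [IsManifold (𝓡∂ m) ∞ A'] [IsManifold (𝓡∂ m) ∞ C'] [IsManifold (𝓡∂ m) ∞ P]

omit [T2Space S] [T2Space C'] [IsManifold (𝓡 m) ∞ S] [IsManifold (𝓡∂ m) ∞ C']
  [IsManifold (𝓡∂ m) ∞ P] [Nonempty ↥(puncture k₁)] [Nonempty ↥(puncture k₂)] in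
/-- The first piece map on the punctured pieces is an immersion (complement `Unit`). [folklore] -/
theorem isImmersionAtOfComplement_lift₁ (a : ↥(puncture k₁)) :
    Manifold.IsImmersionAtOfComplement Unit (𝓡∂ m) (𝓡 m) ∞ J.lift₁ a := by
  have h1 : Manifold.IsImmersionAtOfComplement Unit (𝓡∂ m) (𝓡 m) ∞ J.j₁ a.val :=
    (J.hj₁.isImmersion.isImmersionOfComplement_of_finrank_eq (F₀ := Unit)
      (by simp [Module.finrank_zero_of_subsingleton (M := Unit)])) a.val
  have h2 := h1.comp_subtypeVal (puncture k₁) (y := a)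
  exact h2.codRestrict_opens (puncture D.i₁) (fun y => J.j₁_mem y)

omit [T2Space X] [T2Space A'] [IsManifold (𝓡 m) ∞ X] [IsManifold (𝓡∂ m) ∞ A']
  [IsManifold (𝓡∂ m) ∞ P] [Nonempty ↥(puncture k₁)] [Nonempty ↥(puncture k₂)] in
/-- The second piece map on the punctured pieces is an immersion (complement `Unit`). [folklore] -/
theorem isImmersionAtOfComplement_lift₂ (c : ↥(puncture k₂)) :
    Manifold.IsImmersionAtOfComplement Unit (𝓡∂ m) (𝓡 m) ∞ J.lift₂ c := by
  have h1 : Manifold.IsImmersionAtOfComplement Unit (𝓡∂ m) (𝓡 m) ∞ J.j₂ c.val :=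
    (J.hj₂.isImmersion.isImmersionOfComplement_of_finrank_eq (F₀ := Unit)
      (by simp [Module.finrank_zero_of_subsingleton (M := Unit)])) c.val
  have h2 := h1.comp_subtypeVal (puncture k₂) (y := c)
  exact h2.codRestrict_opens (puncture D.i₂) (fun y => J.j₂_mem y)

/-- The glued map is an immersion (complement `Unit`). [folklore] -/
theorem isImmersionOfComplement_glueMap :
    Manifold.IsImmersionOfComplement Unit (𝓡∂ m) (𝓡 m) ∞ (J.glueMap hm W) := by
  intro p
  rcases W.exists_eq p with ⟨a, rfl⟩ | ⟨c, rfl⟩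
  · have h1 : Manifold.IsImmersionAtOfComplement Unit (𝓡∂ m) (𝓡 m) ∞ (J.lift₁ ∘ W.chart₁.symm)
        (W.ι₁ a) := by
      refine Manifold.IsImmersionAtOfComplement.comp_openPartialHomeomorph W.chart₁.symm
        (by simpa [HalfGluing.chart₁] using W.contMDiffOn_chart₁_symm)
        (by simpa [HalfGluing.chart₁] using contMDiffOn_openEmbeddingChart W.h₁ W.h₁o)
        (by simp [HalfGluing.chart₁]) ?_
      rw [W.chart₁_symm_apply]
      exact J.isImmersionAtOfComplement_lift₁ a
    have h2 := (D.glueData hm).isImmersionAtOfComplement_inl_comp h1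
    refine h2.congr_of_eventuallyEq ?_
    filter_upwards [W.h₁o.mem_nhds ⟨a, rfl⟩] with q hq
    exact (J.glueMap_eqOn_range₁ hm W hq).symm
  · have h1 : Manifold.IsImmersionAtOfComplement Unit (𝓡∂ m) (𝓡 m) ∞ (J.lift₂ ∘ W.chart₂.symm)
        (W.ι₂ c) := by
      refine Manifold.IsImmersionAtOfComplement.comp_openPartialHomeomorph W.chart₂.symm
        (by simpa [HalfGluing.chart₂] using W.contMDiffOn_chart₂_symm)
        (by simpa [HalfGluing.chart₂] using contMDiffOn_openEmbeddingChart W.h₂ W.h₂o)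
        (by simp [HalfGluing.chart₂]) ?_
      rw [W.chart₂_symm_apply]
      exact J.isImmersionAtOfComplement_lift₂ c
    have h2 := (D.glueData hm).isImmersionAtOfComplement_inr_comp h1
    refine h2.congr_of_eventuallyEq ?_
    filter_upwards [W.h₂o.mem_nhds ⟨c, rfl⟩] with q hq
    exact (J.glueMap_eqOn_range₂ hm W hq).symm

/-- **The glued map is a smooth embedding** `A' ♮ C' ↪ X # S` (for compact `A' ♮ C'`). [folklore] -/
theorem isSmoothEmbedding_glueMap [CompactSpace P] :
    Manifold.IsSmoothEmbedding (𝓡∂ m) (𝓡 m) ∞ (J.glueMap hm W) :=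
  ⟨(J.isImmersionOfComplement_glueMap hm W).isImmersion,
    ((J.contMDiff_glueMap hm W).continuous.isClosedEmbedding
      (J.glueMap_injective hm W)).isEmbedding⟩

end PieceMaps

end GlueMap

/-! ### §8 The boundary of a half gluing: `∂(A' ♮ C') = ∂A' # ∂C'` -/

section SplitPiece

variable (n : ℕ)

/-- **A piece of a splitting together with its boundary**: a compact piece `A'` (manifold with
boundary), a closed manifold `N` embedded onto `∂A'` by `g` (for Matveyev's fig. 2: `g = incl_A`
for the piece `A`, and `g = incl_B ∘ φ : ∂A → B` for the piece `B`), a half-disc `k` in `A'` and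
the disc `f` of `N` which is its flat face: `k (0, x') = g (f x')`. [folklore] -/
structure SplitPiece (N : Type u) [TopologicalSpace N] [ChartedSpace (𝔼 (n + 1)) N]
    (A' : Type u) [TopologicalSpace A'] [ChartedSpace (ℍ (n + 2)) A'] where
  /-- the face disc of `N` -/
  f : 𝔼 (n + 1) → N
  /-- the half-disc of `A'` -/
  k : ℍ (n + 2) → A'
  /-- the embedding of `N` onto `∂A'` -/
  g : N → A'
  hf : Manifold.IsSmoothEmbedding 𝓘(ℝ, 𝔼 (n + 1)) (𝓡 (n + 1)) ∞ f
  hfo : IsOpen (range f)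
  hk : Manifold.IsSmoothEmbedding (𝓡∂ (n + 2)) (𝓡∂ (n + 2)) ∞ k
  hko : IsOpen (range k)
  hg : Manifold.IsSmoothEmbedding (𝓡 (n + 1)) (𝓡∂ (n + 2)) ∞ g
  range_g : range g = (𝓡∂ (n + 2)).boundary A'
  face : ∀ x', k (EuclideanHalfSpace.face x') = g (f x')

namespace SplitPiece

variable {n} {N : Type u} [TopologicalSpace N] [ChartedSpace (𝔼 (n + 1)) N]
    {A' : Type u} [TopologicalSpace A'] [ChartedSpace (ℍ (n + 2)) A'] (p : SplitPiece n N A')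

/-- `g` is injective. [folklore] -/
theorem g_injective : Injective p.g := p.hg.isEmbedding.injective

/-- `k` is injective. [folklore] -/
theorem k_injective : Injective p.k := p.hk.isEmbedding.injective

/-- The centre of the half-disc is `g (f 0)`. [folklore] -/
theorem k_zero : p.k 0 = p.g (p.f 0) := by rw [← EuclideanHalfSpace.face_zero, p.face]

/-- The half-disc meets `g (N) = ∂A'` exactly along its flat face. [folklore] -/
theorem k_mem_range_g_iff (x : ℍ (n + 2)) : p.k x ∈ range p.g ↔ x.val 0 = 0 := by
  rw [p.range_g, halfDisc_mem_boundary_iff p.hk p.hko]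

/-- A point of height `0` under `k`: `k x = g (f x')`. [folklore] -/
theorem k_eq_g_f_of_apply_zero (x : ℍ (n + 2)) (hx : x.val 0 = 0) :
    p.k x = p.g (p.f (hsTail x)) := by
  rw [← p.face, EuclideanHalfSpace.face_hsTail_of_apply_zero x hx]

variable [T1Space A']

/-- `g` maps `N ∖ {f 0}` into the punctured piece. [folklore] -/
theorem g_mem_puncture {z : N} (hz : z ≠ p.f 0) : p.g z ∈ puncture p.k := by
  rw [mem_puncture, p.k_zero]
  exact fun h => hz (p.g_injective h)

end SplitPiece

end SplitPiece

section BoundaryMap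

variable {n : ℕ} {N₁ N₂ : Type u}
  [TopologicalSpace N₁] [T2Space N₁] [ChartedSpace (𝔼 (n + 1)) N₁]
  [TopologicalSpace N₂] [T2Space N₂] [ChartedSpace (𝔼 (n + 1)) N₂]
  {A' C' : Type u} [TopologicalSpace A'] [T2Space A'] [ChartedSpace (ℍ (n + 2)) A']
  [TopologicalSpace C'] [T2Space C'] [ChartedSpace (ℍ (n + 2)) C']
  (Dσ : ConnectedSumData (n + 1) N₁ N₂) (p₁ : SplitPiece n N₁ A') (p₂ : SplitPiece n N₂ C')
  (hD₁ : Dσ.i₁ = p₁.f) (hD₂ : Dσ.i₂ = p₂.f)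
  {P : Type u} [TopologicalSpace P] [ChartedSpace (ℍ (n + 2)) P] (W : HalfGluing p₁.k p₂.k P)

namespace SplitPiece

include hD₁ in
omit [T2Space N₂] in
/-- `g₁` maps the punctured boundary into the punctured piece. [folklore] -/
theorem g₁_mem (z : Dσ.A) : p₁.g z.val ∈ puncture p₁.k :=
  p₁.g_mem_puncture fun h => z.2 (by rw [mem_singleton_iff, hD₁]; exact h)

include hD₂ in
omit [T2Space N₁] in
/-- `g₂` maps the punctured boundary into the punctured piece. [folklore] -/
theorem g₂_mem (w : Dσ.B) : p₂.g w.val ∈ puncture p₂.k :=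
  p₂.g_mem_puncture fun h => w.2 (by rw [mem_singleton_iff, hD₂]; exact h)

/-- The first branch of the boundary map: `∂A' ∖ {f₁ 0} → A' ♮ C'`, `z ↦ ι₁ (g₁ z)`. [folklore] -/
def branch₁ (z : Dσ.A) : P := W.ι₁ ⟨p₁.g z.val, g₁_mem Dσ p₁ hD₁ z⟩

/-- The second branch of the boundary map: `∂C' ∖ {f₂ 0} → A' ♮ C'`, `w ↦ ι₂ (g₂ w)`. [folklore] -/
def branch₂ (w : Dσ.B) : P := W.ι₂ ⟨p₂.g w.val, g₂_mem Dσ p₂ hD₂ w⟩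

omit [T2Space N₂] in
/-- Unfolding of the first branch. [folklore] -/
theorem branch₁_apply (z : Dσ.A) : branch₁ Dσ p₁ p₂ hD₁ W z = W.ι₁ ⟨p₁.g z.val, g₁_mem Dσ p₁ hD₁ z⟩ :=
  rfl

omit [T2Space N₁] in
/-- Unfolding of the second branch. [folklore] -/
theorem branch₂_apply (w : Dσ.B) : branch₂ Dσ p₁ p₂ hD₂ W w = W.ι₂ ⟨p₂.g w.val, g₂_mem Dσ p₂ hD₂ w⟩ :=
  rfl

/-- A unit vector of the flat face as a unit vector of the closed half space. [folklore] -/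
theorem norm_val_face_eq_one {u : 𝔼 (n + 1)} (hu : ‖u‖ = 1) :
    ‖(EuclideanHalfSpace.face u).val‖ = 1 := by
  rw [EuclideanHalfSpace.norm_val_face, hu]

include hD₁ hD₂ in
/-- **Kervaire–Milnor's relation on the boundaries implies Juhász's relation on the pieces**:
if `z = f₁ (t • u) ∼ w = f₂ ((1 - t) • u)` then `g₁ z = k₁ (t • (0, u)) ∼ g₂ w = k₂ ((1 - t) • (0, u))`. [folklore] -/
theorem rel_of_connectedSumRel {z : Dσ.A} {w : Dσ.B} (h : connectedSumRel Dσ.i₁ Dσ.i₂ z w) :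
    boundaryConnectedSumRel p₁.k p₂.k ⟨p₁.g z.val, g₁_mem Dσ p₁ hD₁ z⟩
      ⟨p₂.g w.val, g₂_mem Dσ p₂ hD₂ w⟩ := by
  obtain ⟨u, t, hu, ht, hz, hw⟩ := h
  refine ⟨EuclideanHalfSpace.face u, t, norm_val_face_eq_one hu, ht, ?_, ?_⟩
  · change p₁.g z.val = _
    rw [hz, show Dσ.i₁ (t • u) = p₁.f (t • u) from congrFun hD₁ _,
      EuclideanHalfSpace.dilate_face ht.1.le, p₁.face]
  · change p₂.g w.val = _
    rw [hw, show Dσ.i₂ ((1 - t) • u) = p₂.f ((1 - t) • u) from congrFun hD₂ _,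
      EuclideanHalfSpace.dilate_face (by linarith [ht.2]), p₂.face]

include hD₁ hD₂ in
/-- **Juhász's relation on the boundaries of the pieces implies Kervaire–Milnor's**: if
`g₁ z = k₁ (t • v) ∼ g₂ w = k₂ ((1 - t) • v)` then `v = (0, u)` lies on the flat face and
`z = f₁ (t • u) ∼ w = f₂ ((1 - t) • u)`. [folklore] -/
theorem connectedSumRel_of_rel {z : Dσ.A} {w : Dσ.B}
    (h : boundaryConnectedSumRel p₁.k p₂.k ⟨p₁.g z.val, g₁_mem Dσ p₁ hD₁ z⟩
      ⟨p₂.g w.val, g₂_mem Dσ p₂ hD₂ w⟩) :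
    connectedSumRel Dσ.i₁ Dσ.i₂ z w := by
  obtain ⟨v, t, hv, ht, hz, hw⟩ := h
  change p₁.g z.val = _ at hz
  change p₂.g w.val = _ at hw
  -- `v` lies on the flat face
  have hv0 : v.val 0 = 0 := by
    have h1 : (EuclideanHalfSpace.dilate t v).val 0 = 0 :=
      (p₁.k_mem_range_g_iff _).1 ⟨z.val, hz⟩
    rw [EuclideanHalfSpace.val_dilate_apply_zero ht.1.le] at h1
    rcases mul_eq_zero.1 h1 with h2 | h2
    · exact absurd h2 ht.1.ne'
    · exact h2
  set u := hsTail v with hu_def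
  have hvu : EuclideanHalfSpace.face u = v := EuclideanHalfSpace.face_hsTail_of_apply_zero v hv0
  have hu : ‖u‖ = 1 := by
    rw [← EuclideanHalfSpace.norm_val_face u, hvu, hv]
  refine ⟨u, t, hu, ht, ?_, ?_⟩
  · rw [← hvu, EuclideanHalfSpace.dilate_face ht.1.le, p₁.face] at hz
    rw [show Dσ.i₁ (t • u) = p₁.f (t • u) from congrFun hD₁ _]
    exact p₁.g_injective hz
  · rw [← hvu, EuclideanHalfSpace.dilate_face (by linarith [ht.2]), p₂.face] at hw
    rw [show Dσ.i₂ ((1 - t) • u) = p₂.f ((1 - t) • u) from congrFun hD₂ _]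
    exact p₂.g_injective hw

variable (hn1 : n + 1 ≠ 0)

include hD₁ hD₂ in
/-- The two branches agree along the gluing map of `∂A' # ∂C'`. [folklore] -/
theorem branch_compat : ∀ z ∈ (Dσ.glueData hn1).glue.source,
    branch₁ Dσ p₁ p₂ hD₁ W z = branch₂ Dσ p₁ p₂ hD₂ W ((Dσ.glueData hn1).glue z) := by
  intro z hz
  rw [branch₁_apply, branch₂_apply, W.rel]
  apply rel_of_connectedSumRel Dσ p₁ p₂ hD₁ hD₂
  rw [Dσ.connectedSumRel_iff_φ hn1]
  exact ⟨hz, rfl⟩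

/-- **The boundary map** `∂A' # ∂C' → A' ♮ C'`: `inl z ↦ ι₁ (g₁ z)`, `inr w ↦ ι₂ (g₂ w)`. [folklore] -/
def boundaryMap : (Dσ.glueData hn1).Glued → P :=
  (Dσ.glueData hn1).lift (branch₁ Dσ p₁ p₂ hD₁ W) (branch₂ Dσ p₁ p₂ hD₂ W)
    (branch_compat Dσ p₁ p₂ hD₁ hD₂ W hn1)

/-- The boundary map on the first piece: `inl z ↦ ι₁ (g₁ z)`. [folklore] -/
@[simp] theorem boundaryMap_inl (z : Dσ.A) :
    boundaryMap Dσ p₁ p₂ hD₁ hD₂ W hn1 ((Dσ.glueData hn1).inl z) =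
      W.ι₁ ⟨p₁.g z.val, g₁_mem Dσ p₁ hD₁ z⟩ :=
  rfl

/-- The boundary map on the second piece: `inr w ↦ ι₂ (g₂ w)`. [folklore] -/
@[simp] theorem boundaryMap_inr (w : Dσ.B) :
    boundaryMap Dσ p₁ p₂ hD₁ hD₂ W hn1 ((Dσ.glueData hn1).inr w) =
      W.ι₂ ⟨p₂.g w.val, g₂_mem Dσ p₂ hD₂ w⟩ :=
  rfl

/-- The boundary map is injective. [folklore] -/
theorem boundaryMap_injective : Injective (boundaryMap Dσ p₁ p₂ hD₁ hD₂ W hn1) := by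
  intro x y hxy
  rcases (Dσ.glueData hn1).exists_inl_or_inr x with ⟨z, rfl⟩ | ⟨w, rfl⟩ <;>
    rcases (Dσ.glueData hn1).exists_inl_or_inr y with ⟨z', rfl⟩ | ⟨w', rfl⟩
  · rw [boundaryMap_inl, boundaryMap_inl] at hxy
    have h := congrArg Subtype.val (W.ι₁_injective hxy)
    rw [Subtype.ext (p₁.g_injective h)]
  · rw [boundaryMap_inl, boundaryMap_inr, W.rel] at hxy
    rw [Dσ.inl_eq_inr_iff_connectedSumRel hn1]
    exact connectedSumRel_of_rel Dσ p₁ p₂ hD₁ hD₂ hxy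
  · rw [boundaryMap_inr, boundaryMap_inl, eq_comm, W.rel] at hxy
    rw [eq_comm, Dσ.inl_eq_inr_iff_connectedSumRel hn1]
    exact connectedSumRel_of_rel Dσ p₁ p₂ hD₁ hD₂ hxy
  · rw [boundaryMap_inr, boundaryMap_inr] at hxy
    have h := congrArg Subtype.val (W.ι₂_injective hxy)
    rw [Subtype.ext (p₂.g_injective h)]

omit [T2Space N₂] in
/-- The first branch is smooth. [folklore] -/
theorem contMDiff_branch₁ : ContMDiff (𝓡 (n + 1)) (𝓡∂ (n + 2)) ∞ (branch₁ Dσ p₁ p₂ hD₁ W) :=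
  W.h₁.contMDiff.comp ((ContMDiff.subtypeVal_comp_iff _ _).1
    (p₁.hg.contMDiff.comp contMDiff_subtype_val))

omit [T2Space N₁] in
/-- The second branch is smooth. [folklore] -/
theorem contMDiff_branch₂ : ContMDiff (𝓡 (n + 1)) (𝓡∂ (n + 2)) ∞ (branch₂ Dσ p₁ p₂ hD₂ W) :=
  W.h₂.contMDiff.comp ((ContMDiff.subtypeVal_comp_iff _ _).1
    (p₂.hg.contMDiff.comp contMDiff_subtype_val))

variable [IsManifold (𝓡 (n + 1)) ∞ N₁] [IsManifold (𝓡 (n + 1)) ∞ N₂]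

/-- The boundary map is smooth. [folklore] -/
theorem contMDiff_boundaryMap :
    ContMDiff (𝓡 (n + 1)) (𝓡∂ (n + 2)) ∞ (boundaryMap Dσ p₁ p₂ hD₁ hD₂ W hn1) :=
  (Dσ.glueData hn1).contMDiff_lift (contMDiff_branch₁ Dσ p₁ p₂ hD₁ W)
    (contMDiff_branch₂ Dσ p₁ p₂ hD₂ W)

variable [IsManifold (𝓡∂ (n + 2)) ∞ A'] [IsManifold (𝓡∂ (n + 2)) ∞ C'] [IsManifold (𝓡∂ (n + 2)) ∞ P]
  [Nonempty ↥(puncture p₁.k)] [Nonempty ↥(puncture p₂.k)]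

/-- Dimension count `dim ℝⁿ⁺¹ + 1 = dim ℝⁿ⁺²`. [folklore] -/
theorem finrank_face : finrank ℝ (𝔼 (n + 1)) + finrank ℝ ℝ = finrank ℝ (𝔼 (n + 2)) := by
  simp

omit [T2Space N₂] [IsManifold (𝓡 (n + 1)) ∞ N₂] [IsManifold (𝓡∂ (n + 2)) ∞ C']
  [Nonempty ↥(puncture p₂.k)] in
/-- The first branch is an immersion with complement `ℝ` (codimension one). [folklore] -/
theorem isImmersionAtOfComplement_branch₁ (z : Dσ.A) :
    Manifold.IsImmersionAtOfComplement ℝ (𝓡 (n + 1)) (𝓡∂ (n + 2)) ∞ (branch₁ Dσ p₁ p₂ hD₁ W) z := by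
  have h1 : Manifold.IsImmersionAtOfComplement ℝ (𝓡 (n + 1)) (𝓡∂ (n + 2)) ∞ p₁.g z.val :=
    (p₁.hg.isImmersion.isImmersionOfComplement_of_finrank_eq (F₀ := ℝ) finrank_face) z.val
  have h2 := h1.comp_subtypeVal Dσ.A (y := z)
  have h3 := h2.codRestrict_opens (puncture p₁.k) (fun y => g₁_mem Dσ p₁ hD₁ y)
  have h4 := h3.openPartialHomeomorph_comp W.chart₁
    (contMDiffOn_openEmbeddingChart W.h₁ W.h₁o)
    (by simpa [HalfGluing.chart₁] using W.contMDiffOn_chart₁_symm) (by simp [HalfGluing.chart₁])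
  exact h4

omit [T2Space N₁] [IsManifold (𝓡 (n + 1)) ∞ N₁] [IsManifold (𝓡∂ (n + 2)) ∞ A']
  [Nonempty ↥(puncture p₁.k)] in
/-- The second branch is an immersion with complement `ℝ`. [folklore] -/
theorem isImmersionAtOfComplement_branch₂ (w : Dσ.B) :
    Manifold.IsImmersionAtOfComplement ℝ (𝓡 (n + 1)) (𝓡∂ (n + 2)) ∞ (branch₂ Dσ p₁ p₂ hD₂ W) w := by
  have h1 : Manifold.IsImmersionAtOfComplement ℝ (𝓡 (n + 1)) (𝓡∂ (n + 2)) ∞ p₂.g w.val :=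
    (p₂.hg.isImmersion.isImmersionOfComplement_of_finrank_eq (F₀ := ℝ) finrank_face) w.val
  have h2 := h1.comp_subtypeVal Dσ.B (y := w)
  have h3 := h2.codRestrict_opens (puncture p₂.k) (fun y => g₂_mem Dσ p₂ hD₂ y)
  have h4 := h3.openPartialHomeomorph_comp W.chart₂
    (contMDiffOn_openEmbeddingChart W.h₂ W.h₂o)
    (by simpa [HalfGluing.chart₂] using W.contMDiffOn_chart₂_symm) (by simp [HalfGluing.chart₂])
  exact h4

/-- The boundary map is an immersion (complement `ℝ`). [folklore] -/
theorem isImmersionOfComplement_boundaryMap :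
    Manifold.IsImmersionOfComplement ℝ (𝓡 (n + 1)) (𝓡∂ (n + 2)) ∞
      (boundaryMap Dσ p₁ p₂ hD₁ hD₂ W hn1) := by
  intro x
  rcases (Dσ.glueData hn1).exists_inl_or_inr x with ⟨z, rfl⟩ | ⟨w, rfl⟩
  · exact (Dσ.glueData hn1).isImmersionAtOfComplement_lift_inl z
      (isImmersionAtOfComplement_branch₁ Dσ p₁ p₂ hD₁ W z)
  · exact (Dσ.glueData hn1).isImmersionAtOfComplement_lift_inr w
      (isImmersionAtOfComplement_branch₂ Dσ p₁ p₂ hD₂ W w)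

/-- **The boundary map is a smooth embedding** (for compact `∂A'`, `∂C'` and Hausdorff `A' ♮ C'`). [folklore] -/
theorem isSmoothEmbedding_boundaryMap [CompactSpace N₁] [CompactSpace N₂] [T2Space P] :
    Manifold.IsSmoothEmbedding (𝓡 (n + 1)) (𝓡∂ (n + 2)) ∞ (boundaryMap Dσ p₁ p₂ hD₁ hD₂ W hn1) :=
  ⟨(isImmersionOfComplement_boundaryMap Dσ p₁ p₂ hD₁ hD₂ W hn1).isImmersion,
    ((contMDiff_boundaryMap Dσ p₁ p₂ hD₁ hD₂ W hn1).continuous.isClosedEmbedding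
      (boundaryMap_injective Dσ p₁ p₂ hD₁ hD₂ W hn1)).isEmbedding⟩

omit [IsManifold (𝓡 (n + 1)) ∞ N₁] [IsManifold (𝓡 (n + 1)) ∞ N₂] [IsManifold (𝓡∂ (n + 2)) ∞ P]
  [Nonempty ↥(puncture p₁.k)] [Nonempty ↥(puncture p₂.k)] in
/-- **The image of the boundary map is the boundary of `A' ♮ C'`** (open smooth embeddings
preserve boundary points). [folklore] -/
theorem range_boundaryMap :
    range (boundaryMap Dσ p₁ p₂ hD₁ hD₂ W hn1) = (𝓡∂ (n + 2)).boundary P := by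
  have key₁ : ∀ a : ↥(puncture p₁.k), W.ι₁ a ∈ (𝓡∂ (n + 2)).boundary P ↔ a.val ∈ range p₁.g := by
    intro a
    rw [mem_boundary_iff_of_isSmoothEmbedding W.h₁ W.h₁o, mem_boundary_opens_iff, p₁.range_g]
  have key₂ : ∀ c : ↥(puncture p₂.k), W.ι₂ c ∈ (𝓡∂ (n + 2)).boundary P ↔ c.val ∈ range p₂.g := by
    intro c
    rw [mem_boundary_iff_of_isSmoothEmbedding W.h₂ W.h₂o, mem_boundary_opens_iff, p₂.range_g]
  ext q
  constructor
  · rintro ⟨x, rfl⟩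
    rcases (Dσ.glueData hn1).exists_inl_or_inr x with ⟨z, rfl⟩ | ⟨w, rfl⟩
    · rw [boundaryMap_inl, key₁]; exact ⟨z.val, rfl⟩
    · rw [boundaryMap_inr, key₂]; exact ⟨w.val, rfl⟩
  · intro hq
    rcases W.exists_eq q with ⟨a, rfl⟩ | ⟨c, rfl⟩
    · obtain ⟨y, hy⟩ := (key₁ a).1 hq
      have hy0 : y ∈ puncture Dσ.i₁ := by
        rw [mem_puncture, hD₁]
        rintro rfl
        exact a.2 (by rw [mem_singleton_iff, p₁.k_zero, hy])
      refine ⟨(Dσ.glueData hn1).inl ⟨y, hy0⟩, ?_⟩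
      rw [boundaryMap_inl]
      congr 1
      exact Subtype.ext hy
    · obtain ⟨y, hy⟩ := (key₂ c).1 hq
      have hy0 : y ∈ puncture Dσ.i₂ := by
        rw [mem_puncture, hD₂]
        rintro rfl
        exact c.2 (by rw [mem_singleton_iff, p₂.k_zero, hy])
      refine ⟨(Dσ.glueData hn1).inr ⟨y, hy0⟩, ?_⟩
      rw [boundaryMap_inr]
      congr 1
      exact Subtype.ext hy

/-- **The boundary datum of a half gluing**: `∂(A' ♮ C')` is `∂A' # ∂C'` (the connected sum of the
closed manifolds `N₁ ≅ ∂A'`, `N₂ ≅ ∂C'` along the face discs), embedded by the boundary map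
(Juhász, Def. 1.47: "`∂(W₁ ♮ W₂) = ∂W₁ # ∂W₂`"). [cite: Juhasz2023, Def. 1.47] -/
def boundaryData [CompactSpace N₁] [CompactSpace N₂] [T2Space P] :
    BoundaryData (𝓡∂ (n + 2)) P (𝓡 (n + 1)) :=
  ⟨(Dσ.glueData hn1).Glued, boundaryMap Dσ p₁ p₂ hD₁ hD₂ W hn1,
    isSmoothEmbedding_boundaryMap Dσ p₁ p₂ hD₁ hD₂ W hn1,
    range_boundaryMap Dσ p₁ p₂ hD₁ hD₂ W hn1⟩

/-- The inclusion of the boundary datum is the boundary map. [folklore] -/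
@[simp] theorem boundaryData_incl [CompactSpace N₁] [CompactSpace N₂] [T2Space P] :
    (boundaryData Dσ p₁ p₂ hD₁ hD₂ W hn1).incl = boundaryMap Dσ p₁ p₂ hD₁ hD₂ W hn1 :=
  rfl

end SplitPiece

end BoundaryMap

/-! ### §9 Assembly: Matveyev's fig. 2 for seam-adapted witnesses -/

section Tail

variable {n : ℕ}

/-- The tail is linear: `hsTail (t • x) = t • hsTail x`. [folklore] -/
theorem hsTail_ray (u : 𝔼 (n + 2)) (hu : 0 ≤ u 0) (t : ℝ) (ht : 0 ≤ t) :
    hsTail (SeamSide.ray u hu t ht) = t • hsTail (⟨u, by simpa using hu⟩ : ℍ (n + 2)) := by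
  simp only [hsTail, SeamSide.ray_val, BoundaryManifold.tail, map_smul, Prod.smul_fst]

/-- A unit vector of height `0` has a unit tail. [folklore] -/
theorem norm_hsTail_of_apply_zero (x : ℍ (n + 2)) (hx : x.val 0 = 0) : ‖hsTail x‖ = ‖x.val‖ := by
  conv_rhs => rw [← EuclideanHalfSpace.face_hsTail_of_apply_zero x hx]
  rw [EuclideanHalfSpace.norm_val_face]

end Tail

namespace SeamSide

variable {n : ℕ} {A B : Type u} {X : Type v}
  [TopologicalSpace A] [ChartedSpace (ℍ (n + 2)) A]
  [TopologicalSpace B] [ChartedSpace (ℍ (n + 2)) B]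
  [TopologicalSpace X] [ChartedSpace (𝔼 (n + 2)) X]
  (G : SeamSide n A B X)

/-- `kA` of a unit vector is not the centre. [folklore] -/
theorem kA_single_ne_zero : G.kA ⟨EuclideanSpace.single 0 1, by simp⟩ ≠ G.kA 0 := fun h => by
  have h1 : (EuclideanSpace.single 0 1 : 𝔼 (n + 2)) 0 = (0 : ℍ (n + 2)).val 0 :=
    congrArg (fun x : ℍ (n + 2) => x.val 0) (G.kA_injective h)
  have h2 : (0 : ℍ (n + 2)).val 0 = 0 := rfl
  rw [h2] at h1
  simp at h1

/-- `kB` of a unit vector is not the centre. [folklore] -/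
theorem kB_single_ne_zero : G.kB ⟨EuclideanSpace.single 0 1, by simp⟩ ≠ G.kB 0 := fun h => by
  have h1 : (EuclideanSpace.single 0 1 : 𝔼 (n + 2)) 0 = (0 : ℍ (n + 2)).val 0 :=
    congrArg (fun x : ℍ (n + 2) => x.val 0) (G.kB_injective h)
  have h2 : (0 : ℍ (n + 2)).val 0 = 0 := rfl
  rw [h2] at h1
  simp at h1

/-- The first piece with its boundary `∂A` (embedded by `incl_A`). [folklore] -/
def pieceA : SplitPiece n G.bA.carrier A :=
  ⟨G.fA, G.kA, G.bA.incl, G.isSmoothEmbedding_fA, G.isOpen_range_fA, G.hkA, G.hkAo,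
    G.bA.isSmoothEmbedding, G.bA.range_incl, G.faceA⟩

/-- Field unfolding. [folklore] -/
@[simp] theorem pieceA_f : G.pieceA.f = G.fA := rfl
/-- Field unfolding. [folklore] -/
@[simp] theorem pieceA_k : G.pieceA.k = G.kA := rfl
/-- Field unfolding. [folklore] -/
@[simp] theorem pieceA_g : G.pieceA.g = G.bA.incl := rfl

/-- The second piece with the boundary `∂A` embedded by `incl_B ∘ φ`. [folklore] -/
def pieceB : SplitPiece n G.bA.carrier B :=
  ⟨G.fA, G.kB, G.bB.incl ∘ G.φ, G.isSmoothEmbedding_fA, G.isOpen_range_fA, G.hkB, G.hkBo,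
    G.bB.isSmoothEmbedding.comp_diffeomorph G.φ, by
      rw [range_comp, EquivLike.range_eq_univ, image_univ, G.bB.range_incl], G.faceB⟩

/-- Field unfolding. [folklore] -/
@[simp] theorem pieceB_f : G.pieceB.f = G.fA := rfl
/-- Field unfolding. [folklore] -/
@[simp] theorem pieceB_k : G.pieceB.k = G.kB := rfl
/-- Field unfolding. [folklore] -/
@[simp] theorem pieceB_g : G.pieceB.g = G.bB.incl ∘ G.φ := rfl

section Punctures

variable [T2Space A] [T2Space B]

/-- `∂A` is Hausdorff (it embeds into `A`). [folklore] -/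
instance t2Space_carrier_bA : T2Space G.bA.carrier := G.bA.isSmoothEmbedding.isEmbedding.t2Space

omit [T2Space B] in
/-- The punctured piece `A ∖ {kA 0}` is nonempty. [folklore] -/
instance nonempty_puncture_kA : Nonempty ↥(puncture G.kA) :=
  ⟨⟨G.kA ⟨EuclideanSpace.single 0 1, by simp⟩, G.kA_single_ne_zero⟩⟩

omit [T2Space A] in
/-- The punctured piece `B ∖ {kB 0}` is nonempty. [folklore] -/
instance nonempty_puncture_kB : Nonempty ↥(puncture G.kB) :=
  ⟨⟨G.kB ⟨EuclideanSpace.single 0 1, by simp⟩, G.kB_single_ne_zero⟩⟩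

omit [T2Space B] in
/-- Instance restated for the bundled piece. [folklore] -/
instance nonempty_puncture_pieceA_k : Nonempty ↥(puncture G.pieceA.k) := G.nonempty_puncture_kA

omit [T2Space A] in
/-- Instance restated for the bundled piece. [folklore] -/
instance nonempty_puncture_pieceB_k : Nonempty ↥(puncture G.pieceB.k) := G.nonempty_puncture_kB

end Punctures

section Compact

variable [IsManifold (𝓡∂ (n + 2)) ∞ A] [CompactSpace A]

/-- `∂A`, the boundary manifold of the compact `A`, is compact. [folklore] -/
instance compactSpace_carrier_bA : CompactSpace G.bA.carrier := G.bA.compactSpace_carrier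

end Compact

/-! #### Seam points -/

/-- **A point of the disc `i` on the equatorial hyperplane is a seam point**: for a unit vector `u`
of height `0` and `0 ≤ t ≤ 1`, `i (t • u) = jA (incl (fA (t • u')))` with `u'` the tail of `u`.
[folklore] -/
theorem i_smul_of_apply_zero {u : 𝔼 (n + 2)} (hu : ‖u‖ = 1) (h0 : u 0 = 0) {t : ℝ}
    (ht0 : 0 ≤ t) (ht1 : t ≤ 1) :
    G.i (t • u) = G.jA (G.bA.incl (G.fA (t • hsTail (⟨u, by simp [h0]⟩ : ℍ (n + 2))))) := by
  rw [i_smul_of_nonneg hu h0.ge ht0 ht1, G.kA_eq_incl_fA_of_apply_zero _ (by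
    change (t • u) 0 = 0; simp [h0]), hsTail_ray]

end SeamSide

section Assembly

variable {n : ℕ} {A B C D X : Type u} {S : Type v}
  [TopologicalSpace A] [T2Space A] [ChartedSpace (ℍ (n + 2)) A] [IsManifold (𝓡∂ (n + 2)) ∞ A]
  [TopologicalSpace B] [T2Space B] [ChartedSpace (ℍ (n + 2)) B] [IsManifold (𝓡∂ (n + 2)) ∞ B]
  [TopologicalSpace C] [T2Space C] [ChartedSpace (ℍ (n + 2)) C] [IsManifold (𝓡∂ (n + 2)) ∞ C]
  [TopologicalSpace D] [T2Space D] [ChartedSpace (ℍ (n + 2)) D] [IsManifold (𝓡∂ (n + 2)) ∞ D]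
  [TopologicalSpace X] [T2Space X] [ChartedSpace (𝔼 (n + 2)) X] [IsManifold (𝓡 (n + 2)) ∞ X]
  [TopologicalSpace S] [T2Space S] [ChartedSpace (𝔼 (n + 2)) S] [IsManifold (𝓡 (n + 2)) ∞ S]
  (G₁ : SeamSide n A B X) (G₂ : SeamSide n C D S)

namespace SeamSide

/-- `n + 2 ≠ 0`. [folklore] -/
theorem two_ne : n + 2 ≠ 0 := by omega
/-- `n + 1 ≠ 0`. [folklore] -/
theorem one_ne : n + 1 ≠ 0 := by omega

/-- **The connected sum datum of `X # S` along the discs straddling the seams.** [folklore] -/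
def pairData : ConnectedSumData (n + 2) X S :=
  ⟨Classical.choose (ConnectedSumData.exists_of_isSmoothEmbedding G₁.hi),
    Classical.choose (ConnectedSumData.exists_of_isSmoothEmbedding G₂.hi),
    (Classical.choose_spec (ConnectedSumData.exists_of_isSmoothEmbedding G₁.hi)).1,
    (Classical.choose_spec (ConnectedSumData.exists_of_isSmoothEmbedding G₂.hi)).1,
    (Classical.choose_spec (ConnectedSumData.exists_of_isSmoothEmbedding G₁.hi)).2.1,
    (Classical.choose_spec (ConnectedSumData.exists_of_isSmoothEmbedding G₂.hi)).2.1⟩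

omit [T2Space A] [IsManifold (𝓡∂ (n + 2)) ∞ A] [T2Space B] [IsManifold (𝓡∂ (n + 2)) ∞ B] [T2Space C]
  [IsManifold (𝓡∂ (n + 2)) ∞ C] [T2Space D] [IsManifold (𝓡∂ (n + 2)) ∞ D] [T2Space X] [T2Space S] in
/-- The first disc of the connected sum datum is `i_X`. [folklore] -/
@[simp] theorem pairData_i₁ : (pairData G₁ G₂).i₁ = G₁.i :=
  (Classical.choose_spec (ConnectedSumData.exists_of_isSmoothEmbedding G₁.hi)).2.2

omit [T2Space A] [IsManifold (𝓡∂ (n + 2)) ∞ A] [T2Space B] [IsManifold (𝓡∂ (n + 2)) ∞ B] [T2Space C]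
  [IsManifold (𝓡∂ (n + 2)) ∞ C] [T2Space D] [IsManifold (𝓡∂ (n + 2)) ∞ D] [T2Space X] [T2Space S] in
/-- The second disc of the connected sum datum is `i_S`. [folklore] -/
@[simp] theorem pairData_i₂ : (pairData G₁ G₂).i₂ = G₂.i :=
  (Classical.choose_spec (ConnectedSumData.exists_of_isSmoothEmbedding G₂.hi)).2.2

/-- **The connected sum datum of `∂A # ∂C` along the face discs.** [folklore] -/
def sigmaData : ConnectedSumData (n + 1) G₁.bA.carrier G₂.bA.carrier :=
  ⟨Classical.choose (ConnectedSumData.exists_of_isSmoothEmbedding G₁.isSmoothEmbedding_fA),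
    Classical.choose (ConnectedSumData.exists_of_isSmoothEmbedding G₂.isSmoothEmbedding_fA),
    (Classical.choose_spec
      (ConnectedSumData.exists_of_isSmoothEmbedding G₁.isSmoothEmbedding_fA)).1,
    (Classical.choose_spec
      (ConnectedSumData.exists_of_isSmoothEmbedding G₂.isSmoothEmbedding_fA)).1,
    (Classical.choose_spec
      (ConnectedSumData.exists_of_isSmoothEmbedding G₁.isSmoothEmbedding_fA)).2.1,
    (Classical.choose_spec
      (ConnectedSumData.exists_of_isSmoothEmbedding G₂.isSmoothEmbedding_fA)).2.1⟩

omit [T2Space A] [IsManifold (𝓡∂ (n + 2)) ∞ A] [T2Space B] [IsManifold (𝓡∂ (n + 2)) ∞ B] [T2Space C]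
  [IsManifold (𝓡∂ (n + 2)) ∞ C] [T2Space D] [IsManifold (𝓡∂ (n + 2)) ∞ D] [T2Space X] [IsManifold (𝓡 (n + 2)) ∞ X]
  [T2Space S] [IsManifold (𝓡 (n + 2)) ∞ S] in
/-- The first disc of the boundary datum is `fA`. [folklore] -/
@[simp] theorem sigmaData_i₁ : (sigmaData G₁ G₂).i₁ = G₁.fA :=
  (Classical.choose_spec (ConnectedSumData.exists_of_isSmoothEmbedding G₁.isSmoothEmbedding_fA)).2.2

omit [T2Space A] [IsManifold (𝓡∂ (n + 2)) ∞ A] [T2Space B] [IsManifold (𝓡∂ (n + 2)) ∞ B] [T2Space C]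
  [IsManifold (𝓡∂ (n + 2)) ∞ C] [T2Space D] [IsManifold (𝓡∂ (n + 2)) ∞ D] [T2Space X] [IsManifold (𝓡 (n + 2)) ∞ X]
  [T2Space S] [IsManifold (𝓡 (n + 2)) ∞ S] in
/-- The second disc of the boundary datum is `fC`. [folklore] -/
@[simp] theorem sigmaData_i₂ : (sigmaData G₁ G₂).i₂ = G₂.fA :=
  (Classical.choose_spec (ConnectedSumData.exists_of_isSmoothEmbedding G₂.isSmoothEmbedding_fA)).2.2

/-- The glued manifold `∂A # ∂C` (as a gluing datum). [folklore] -/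
abbrev sigmaGlue := (sigmaData G₁ G₂).glueData one_ne

omit [T2Space A] [IsManifold (𝓡∂ (n + 2)) ∞ A] [T2Space B] [IsManifold (𝓡∂ (n + 2)) ∞ B] [T2Space C]
  [IsManifold (𝓡∂ (n + 2)) ∞ C] [T2Space D] [IsManifold (𝓡∂ (n + 2)) ∞ D] [T2Space X] [IsManifold (𝓡 (n + 2)) ∞ X]
  [T2Space S] [IsManifold (𝓡 (n + 2)) ∞ S] in
/-- The first disc is the face disc of the bundled piece `A`. [folklore] -/
theorem sigmaData_i₁' : (sigmaData G₁ G₂).i₁ = G₁.pieceA.f := sigmaData_i₁ G₁ G₂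
omit [T2Space A] [IsManifold (𝓡∂ (n + 2)) ∞ A] [T2Space B] [IsManifold (𝓡∂ (n + 2)) ∞ B] [T2Space C]
  [IsManifold (𝓡∂ (n + 2)) ∞ C] [T2Space D] [IsManifold (𝓡∂ (n + 2)) ∞ D] [T2Space X] [IsManifold (𝓡 (n + 2)) ∞ X]
  [T2Space S] [IsManifold (𝓡 (n + 2)) ∞ S] in
/-- The second disc is the face disc of the bundled piece `C`. [folklore] -/
theorem sigmaData_i₂' : (sigmaData G₁ G₂).i₂ = G₂.pieceA.f := sigmaData_i₂ G₁ G₂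
omit [T2Space A] [IsManifold (𝓡∂ (n + 2)) ∞ A] [T2Space B] [IsManifold (𝓡∂ (n + 2)) ∞ B] [T2Space C]
  [IsManifold (𝓡∂ (n + 2)) ∞ C] [T2Space D] [IsManifold (𝓡∂ (n + 2)) ∞ D] [T2Space X] [IsManifold (𝓡 (n + 2)) ∞ X]
  [T2Space S] [IsManifold (𝓡 (n + 2)) ∞ S] in
/-- The first disc is the face disc of the bundled piece `B`. [folklore] -/
theorem sigmaData_i₁'' : (sigmaData G₁ G₂).i₁ = G₁.pieceB.f := sigmaData_i₁ G₁ G₂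
omit [T2Space A] [IsManifold (𝓡∂ (n + 2)) ∞ A] [T2Space B] [IsManifold (𝓡∂ (n + 2)) ∞ B] [T2Space C]
  [IsManifold (𝓡∂ (n + 2)) ∞ C] [T2Space D] [IsManifold (𝓡∂ (n + 2)) ∞ D] [T2Space X] [IsManifold (𝓡 (n + 2)) ∞ X]
  [T2Space S] [IsManifold (𝓡 (n + 2)) ∞ S] in
/-- The second disc is the face disc of the bundled piece `D`. [folklore] -/
theorem sigmaData_i₂'' : (sigmaData G₁ G₂).i₂ = G₂.pieceB.f := sigmaData_i₂ G₁ G₂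

/-! #### Correspondence of the relations -/

omit [IsManifold (𝓡∂ (n + 2)) ∞ A] [IsManifold (𝓡∂ (n + 2)) ∞ B] [IsManifold (𝓡∂ (n + 2)) ∞ C]
  [IsManifold (𝓡∂ (n + 2)) ∞ D] [T2Space X] [IsManifold (𝓡 (n + 2)) ∞ X] [T2Space S]
  [IsManifold (𝓡 (n + 2)) ∞ S] [T2Space A] [T2Space B] [T2Space C] [T2Space D] in
/-- **Juhász's relation along `kA, kC` is Kervaire–Milnor's along the discs `i_X, i_S`** on the
first pieces. [folklore] -/
theorem first_compat (a : A) (c : C) :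
    (∃ (v : ℍ (n + 2)) (t : ℝ), ‖v.val‖ = 1 ∧ t ∈ Ioo (0 : ℝ) 1 ∧
        a = G₁.kA (EuclideanHalfSpace.dilate t v) ∧ c = G₂.kA (EuclideanHalfSpace.dilate (1 - t) v)) ↔
      ∃ (u : 𝔼 (n + 2)) (t : ℝ), ‖u‖ = 1 ∧ t ∈ Ioo (0 : ℝ) 1 ∧
        G₁.jA a = G₁.i (t • u) ∧ G₂.jA c = G₂.i ((1 - t) • u) := by
  constructor
  · rintro ⟨v, t, hv, ht, rfl, rfl⟩
    refine ⟨v.val, t, hv, ht, ?_, ?_⟩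
    · rw [← G₁.i_upper _ (by rw [EuclideanHalfSpace.norm_val_dilate ht.1.le hv]; exact ht.2.le),
        EuclideanHalfSpace.val_dilate_of_nonneg ht.1.le]
    · rw [← G₂.i_upper _ (by
          rw [EuclideanHalfSpace.norm_val_dilate (by linarith [ht.2]) hv]; linarith [ht.1]),
        EuclideanHalfSpace.val_dilate_of_nonneg (by linarith [ht.2])]
  · rintro ⟨u, t, hu, ht, ha, hc⟩
    have h0 : 0 ≤ u 0 := nonneg_of_i_smul_eq_jA hu ht.1 ht.2.le ha.symm
    rw [i_smul_of_nonneg hu h0 ht.1.le ht.2.le] at ha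
    rw [i_smul_of_nonneg hu h0 (by linarith [ht.2]) (by linarith [ht.1])] at hc
    refine ⟨⟨u, by simpa using h0⟩, t, hu, ht, ?_, ?_⟩
    · rw [← ray_eq_dilate u h0 t ht.1.le]; exact G₁.jA_injective ha
    · rw [← ray_eq_dilate u h0 (1 - t) (by linarith [ht.2])]; exact G₂.jA_injective hc

omit [IsManifold (𝓡∂ (n + 2)) ∞ A] [IsManifold (𝓡∂ (n + 2)) ∞ B] [IsManifold (𝓡∂ (n + 2)) ∞ C]
  [IsManifold (𝓡∂ (n + 2)) ∞ D] [T2Space X] [IsManifold (𝓡 (n + 2)) ∞ X] [T2Space S]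
  [IsManifold (𝓡 (n + 2)) ∞ S] [T2Space A] [T2Space B] [T2Space C] [T2Space D] in
/-- **Juhász's relation along `kB, kD` is Kervaire–Milnor's along the discs `i_X, i_S`** on the
second pieces (through the reflection in the flat face). [folklore] -/
theorem second_compat (b : B) (d : D) :
    (∃ (v : ℍ (n + 2)) (t : ℝ), ‖v.val‖ = 1 ∧ t ∈ Ioo (0 : ℝ) 1 ∧
        b = G₁.kB (EuclideanHalfSpace.dilate t v) ∧ d = G₂.kB (EuclideanHalfSpace.dilate (1 - t) v)) ↔
      ∃ (u : 𝔼 (n + 2)) (t : ℝ), ‖u‖ = 1 ∧ t ∈ Ioo (0 : ℝ) 1 ∧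
        G₁.jB b = G₁.i (t • u) ∧ G₂.jB d = G₂.i ((1 - t) • u) := by
  constructor
  · rintro ⟨v, t, hv, ht, rfl, rfl⟩
    refine ⟨reflectZero v.val, t, by rw [norm_reflectZero, hv], ht, ?_, ?_⟩
    · rw [← reflectZero_smul, ← EuclideanHalfSpace.val_dilate_of_nonneg ht.1.le,
        G₁.i_lower _ (by rw [EuclideanHalfSpace.norm_val_dilate ht.1.le hv]; exact ht.2.le)]
    · rw [← reflectZero_smul, ← EuclideanHalfSpace.val_dilate_of_nonneg (by linarith [ht.2]),
        G₂.i_lower _ (by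
          rw [EuclideanHalfSpace.norm_val_dilate (by linarith [ht.2]) hv]; linarith [ht.1])]
  · rintro ⟨u, t, hu, ht, hb, hd⟩
    have h0 : u 0 ≤ 0 := nonpos_of_i_smul_eq_jB hu ht.1 ht.2.le hb.symm
    rw [i_smul_of_nonpos hu h0 ht.1.le ht.2.le] at hb
    rw [i_smul_of_nonpos hu h0 (by linarith [ht.2]) (by linarith [ht.1])] at hd
    refine ⟨⟨reflectZero u, reflectZero_mem_halfSpace h0⟩, t, by
      change ‖reflectZero u‖ = 1; rw [norm_reflectZero, hu], ht, ?_, ?_⟩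
    · rw [← ray_eq_dilate (reflectZero u) (reflectZero_mem_halfSpace h0) t ht.1.le]
      exact G₁.jB_injective hb
    · rw [← ray_eq_dilate (reflectZero u) (reflectZero_mem_halfSpace h0) (1 - t)
        (by linarith [ht.2])]
      exact G₂.jB_injective hd

/-- The embeddings of the first pieces `A`, `C` into `X`, `S`. [folklore] -/
def mapsFirst : PieceMaps (pairData G₁ G₂) G₁.kA G₂.kA where
  j₁ := G₁.jA
  j₂ := G₂.jA
  hj₁ := G₁.hjA
  hj₂ := G₂.hjA
  centre₁ := by rw [pairData_i₁, G₁.i_zero]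
  centre₂ := by rw [pairData_i₂, G₂.i_zero]
  compat a c := by
    rw [first_compat]
    simp only [pairData_i₁, pairData_i₂]

/-- The embeddings of the second pieces `B`, `D` into `X`, `S`. [folklore] -/
def mapsSecond : PieceMaps (pairData G₁ G₂) G₁.kB G₂.kB where
  j₁ := G₁.jB
  j₂ := G₂.jB
  hj₁ := G₁.hjB
  hj₂ := G₂.hjB
  centre₁ := by rw [pairData_i₁, G₁.i_zero']
  centre₂ := by rw [pairData_i₂, G₂.i_zero']
  compat b d := by
    rw [second_compat]
    simp only [pairData_i₁, pairData_i₂]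

omit [T2Space A] [IsManifold (𝓡∂ (n + 2)) ∞ A] [T2Space B] [IsManifold (𝓡∂ (n + 2)) ∞ B] [T2Space C]
  [IsManifold (𝓡∂ (n + 2)) ∞ C] [T2Space D] [IsManifold (𝓡∂ (n + 2)) ∞ D] [T2Space X] [T2Space S] in
/-- Field unfolding. [folklore] -/
@[simp] theorem mapsFirst_j₁ : (mapsFirst G₁ G₂).j₁ = G₁.jA := rfl
omit [T2Space A] [IsManifold (𝓡∂ (n + 2)) ∞ A] [T2Space B] [IsManifold (𝓡∂ (n + 2)) ∞ B] [T2Space C]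
  [IsManifold (𝓡∂ (n + 2)) ∞ C] [T2Space D] [IsManifold (𝓡∂ (n + 2)) ∞ D] [T2Space X] [T2Space S] in
/-- Field unfolding. [folklore] -/
@[simp] theorem mapsFirst_j₂ : (mapsFirst G₁ G₂).j₂ = G₂.jA := rfl
omit [T2Space A] [IsManifold (𝓡∂ (n + 2)) ∞ A] [T2Space B] [IsManifold (𝓡∂ (n + 2)) ∞ B] [T2Space C]
  [IsManifold (𝓡∂ (n + 2)) ∞ C] [T2Space D] [IsManifold (𝓡∂ (n + 2)) ∞ D] [T2Space X] [T2Space S] in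
/-- Field unfolding. [folklore] -/
@[simp] theorem mapsSecond_j₁ : (mapsSecond G₁ G₂).j₁ = G₁.jB := rfl
omit [T2Space A] [IsManifold (𝓡∂ (n + 2)) ∞ A] [T2Space B] [IsManifold (𝓡∂ (n + 2)) ∞ B] [T2Space C]
  [IsManifold (𝓡∂ (n + 2)) ∞ C] [T2Space D] [IsManifold (𝓡∂ (n + 2)) ∞ D] [T2Space X] [T2Space S] in
/-- Field unfolding. [folklore] -/
@[simp] theorem mapsSecond_j₂ : (mapsSecond G₁ G₂).j₂ = G₂.jB := rfl

/-! #### Seam points of the connected sum -/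

omit [IsManifold (𝓡∂ (n + 2)) ∞ A] [T2Space B] [IsManifold (𝓡∂ (n + 2)) ∞ B] [IsManifold (𝓡∂ (n + 2)) ∞ C] [T2Space D]
  [IsManifold (𝓡∂ (n + 2)) ∞ D] [T2Space X] [IsManifold (𝓡 (n + 2)) ∞ X] [T2Space S] [IsManifold (𝓡 (n + 2)) ∞ S] in
/-- **Equatorial points of the straddling discs are identified boundary points.** For a unit
vector `u` of height `0` and `0 < t < 1` let `u'` be its tail, `z = fA (t • u')`,
`w = fC ((1 - t) • u')`. Then `z ≠ fA 0`, `w ≠ fC 0`, `inl z = inr w` in `∂A # ∂C`, and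
`i_X (t • u)`, `i_S ((1 - t) • u)` are the seam points over `z`, `w`. [folklore] -/
theorem seam_point {u : 𝔼 (n + 2)} (hu : ‖u‖ = 1) (h0 : u 0 = 0) {t : ℝ} (ht : t ∈ Ioo (0 : ℝ) 1) :
    ∃ (z : (sigmaData G₁ G₂).A) (w : (sigmaData G₁ G₂).B),
      (sigmaGlue G₁ G₂).inl z = (sigmaGlue G₁ G₂).inr w ∧
      G₁.i (t • u) = G₁.jA (G₁.bA.incl z.val) ∧
      G₂.i ((1 - t) • u) = G₂.jA (G₂.bA.incl w.val) := by
  set û : ℍ (n + 2) := ⟨u, by simp [h0]⟩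
  set u' := hsTail û with hu'
  have hn' : ‖u'‖ = 1 := by rw [hu', norm_hsTail_of_apply_zero û h0]; exact hu
  have hne' : u' ≠ 0 := by
    intro h; rw [h, norm_zero] at hn'; exact zero_ne_one hn'
  have hz0 : G₁.fA (t • u') ≠ G₁.fA 0 := fun h =>
    (smul_ne_zero ht.1.ne' hne') (G₁.fA_injective h)
  have hw0 : G₂.fA ((1 - t) • u') ≠ G₂.fA 0 := fun h =>
    (smul_ne_zero (by linarith [ht.2] : (1 - t) ≠ 0) hne') (G₂.fA_injective h)
  have hzA : G₁.fA (t • u') ∈ (sigmaData G₁ G₂).A := by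
    rw [mem_puncture, sigmaData_i₁]; exact hz0
  have hwB : G₂.fA ((1 - t) • u') ∈ (sigmaData G₁ G₂).B := by
    rw [mem_puncture, sigmaData_i₂]; exact hw0
  refine ⟨⟨_, hzA⟩, ⟨_, hwB⟩, ?_, ?_, ?_⟩
  · rw [ConnectedSumData.inl_eq_inr_iff_connectedSumRel]
    refine ⟨u', t, hn', ht, ?_, ?_⟩
    · change G₁.fA (t • u') = (sigmaData G₁ G₂).i₁ (t • u'); rw [sigmaData_i₁]
    · change G₂.fA ((1 - t) • u') = (sigmaData G₁ G₂).i₂ ((1 - t) • u'); rw [sigmaData_i₂]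
  · exact G₁.i_smul_of_apply_zero hu h0 ht.1.le ht.2.le
  · exact G₂.i_smul_of_apply_zero hu h0 (by linarith [ht.2]) (by linarith [ht.1])

/-! #### The two embeddings of `A ♮ C` and `B ♮ D` into `X # S`, and their intersection -/

variable {PAC PBD : Type u}
  [TopologicalSpace PAC] [T2Space PAC] [ChartedSpace (ℍ (n + 2)) PAC] [IsManifold (𝓡∂ (n + 2)) ∞ PAC]
  [TopologicalSpace PBD] [T2Space PBD] [ChartedSpace (ℍ (n + 2)) PBD] [IsManifold (𝓡∂ (n + 2)) ∞ PBD]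
  (W : HalfGluing G₁.kA G₂.kA PAC) (W' : HalfGluing G₁.kB G₂.kB PBD)
  [CompactSpace A] [CompactSpace B] [CompactSpace C] [CompactSpace D]

/-- The boundary datum `∂(A ♮ C) = ∂A # ∂C` of `A ♮ C`. [cite: Juhasz2023, Def. 1.47] -/
def βAC : BoundaryData (𝓡∂ (n + 2)) PAC (𝓡 (n + 1)) :=
  SplitPiece.boundaryData (sigmaData G₁ G₂) G₁.pieceA G₂.pieceA (sigmaData_i₁' G₁ G₂)
    (sigmaData_i₂' G₁ G₂) W one_ne

/-- The boundary datum `∂(B ♮ D) = ∂A # ∂C` of `B ♮ D` (embedded through `φ # χ`). [cite: Juhasz2023, Def. 1.47] -/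
def βBD : BoundaryData (𝓡∂ (n + 2)) PBD (𝓡 (n + 1)) :=
  SplitPiece.boundaryData (sigmaData G₁ G₂) G₁.pieceB G₂.pieceB (sigmaData_i₁'' G₁ G₂)
    (sigmaData_i₂'' G₁ G₂) W' one_ne

omit [CompactSpace B] [CompactSpace D] [T2Space B] [IsManifold (𝓡∂ (n + 2)) ∞ B] [T2Space D] [IsManifold (𝓡∂ (n + 2)) ∞ D]
  [T2Space X] [IsManifold (𝓡 (n + 2)) ∞ X] [T2Space S] [IsManifold (𝓡 (n + 2)) ∞ S] in
/-- `∂(A ♮ C)` on the `∂A`-part: `inl z ↦ ιA (incl_A z)`. [folklore] -/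
theorem βAC_incl_inl (z : (sigmaData G₁ G₂).A) :
    (βAC G₁ G₂ W).incl ((sigmaGlue G₁ G₂).inl z) =
      W.ι₁ ⟨G₁.bA.incl z.val, SplitPiece.g₁_mem _ G₁.pieceA (sigmaData_i₁' G₁ G₂) z⟩ :=
  rfl

omit [CompactSpace B] [CompactSpace D] [T2Space B] [IsManifold (𝓡∂ (n + 2)) ∞ B] [T2Space D] [IsManifold (𝓡∂ (n + 2)) ∞ D]
  [T2Space X] [IsManifold (𝓡 (n + 2)) ∞ X] [T2Space S] [IsManifold (𝓡 (n + 2)) ∞ S] in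
/-- `∂(A ♮ C)` on the `∂C`-part: `inr w ↦ ιC (incl_C w)`. [folklore] -/
theorem βAC_incl_inr (w : (sigmaData G₁ G₂).B) :
    (βAC G₁ G₂ W).incl ((sigmaGlue G₁ G₂).inr w) =
      W.ι₂ ⟨G₂.bA.incl w.val, SplitPiece.g₂_mem _ G₂.pieceA (sigmaData_i₂' G₁ G₂) w⟩ :=
  rfl

omit [CompactSpace B] [CompactSpace D] [T2Space X] [IsManifold (𝓡 (n + 2)) ∞ X] [T2Space S] [IsManifold (𝓡 (n + 2)) ∞ S] in
/-- `∂(B ♮ D)` on the `∂A`-part: `inl z ↦ ιB (incl_B (φ z))`. [folklore] -/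
theorem βBD_incl_inl (z : (sigmaData G₁ G₂).A) :
    (βBD G₁ G₂ W').incl ((sigmaGlue G₁ G₂).inl z) =
      W'.ι₁ ⟨G₁.bB.incl (G₁.φ z.val), SplitPiece.g₁_mem _ G₁.pieceB (sigmaData_i₁'' G₁ G₂) z⟩ :=
  rfl

omit [CompactSpace B] [CompactSpace D] [T2Space X] [IsManifold (𝓡 (n + 2)) ∞ X] [T2Space S] [IsManifold (𝓡 (n + 2)) ∞ S] in
/-- `∂(B ♮ D)` on the `∂C`-part: `inr w ↦ ιD (incl_D (χ w))`. [folklore] -/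
theorem βBD_incl_inr (w : (sigmaData G₁ G₂).B) :
    (βBD G₁ G₂ W').incl ((sigmaGlue G₁ G₂).inr w) =
      W'.ι₂ ⟨G₂.bB.incl (G₂.φ w.val), SplitPiece.g₂_mem _ G₂.pieceB (sigmaData_i₂'' G₁ G₂) w⟩ :=
  rfl

/-- The embedding `e : A ♮ C → X # S`. [folklore] -/
def eAC : PAC → ((pairData G₁ G₂).glueData two_ne).Glued := (mapsFirst G₁ G₂).glueMap two_ne W

/-- The embedding `e' : B ♮ D → X # S`. [folklore] -/
def eBD : PBD → ((pairData G₁ G₂).glueData two_ne).Glued := (mapsSecond G₁ G₂).glueMap two_ne W'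

omit [T2Space PAC] [IsManifold (𝓡∂ (n + 2)) ∞ PAC] [CompactSpace B] [CompactSpace C] [CompactSpace D]
  [IsManifold (𝓡∂ (n + 2)) ∞ A] [T2Space B] [IsManifold (𝓡∂ (n + 2)) ∞ B] [IsManifold (𝓡∂ (n + 2)) ∞ C] [T2Space D] [IsManifold (𝓡∂ (n + 2)) ∞ D] in
/-- `e` on the `A`-part: `ιA a ↦ inl (jA a)`. [folklore] -/
theorem eAC_ι₁ (a : ↥(puncture G₁.kA)) :
    eAC G₁ G₂ W (W.ι₁ a) = ((pairData G₁ G₂).glueData two_ne).inl ((mapsFirst G₁ G₂).lift₁ a) :=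
  (mapsFirst G₁ G₂).glueMap_ι₁ two_ne W a

omit [T2Space PAC] [IsManifold (𝓡∂ (n + 2)) ∞ PAC] [CompactSpace A] [CompactSpace B] [CompactSpace D]
  [IsManifold (𝓡∂ (n + 2)) ∞ A] [T2Space B] [IsManifold (𝓡∂ (n + 2)) ∞ B] [IsManifold (𝓡∂ (n + 2)) ∞ C] [T2Space D] [IsManifold (𝓡∂ (n + 2)) ∞ D] in
/-- `e` on the `C`-part: `ιC c ↦ inr (jC c)`. [folklore] -/
theorem eAC_ι₂ (c : ↥(puncture G₂.kA)) :
    eAC G₁ G₂ W (W.ι₂ c) = ((pairData G₁ G₂).glueData two_ne).inr ((mapsFirst G₁ G₂).lift₂ c) :=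
  (mapsFirst G₁ G₂).glueMap_ι₂ two_ne W c

omit [T2Space PBD] [IsManifold (𝓡∂ (n + 2)) ∞ PBD] [CompactSpace A] [CompactSpace C] [CompactSpace D]
  [T2Space A] [IsManifold (𝓡∂ (n + 2)) ∞ A] [IsManifold (𝓡∂ (n + 2)) ∞ B] [T2Space C] [IsManifold (𝓡∂ (n + 2)) ∞ C] [IsManifold (𝓡∂ (n + 2)) ∞ D] in
/-- `e'` on the `B`-part: `ιB b ↦ inl (jB b)`. [folklore] -/
theorem eBD_ι₁ (b : ↥(puncture G₁.kB)) :
    eBD G₁ G₂ W' (W'.ι₁ b) = ((pairData G₁ G₂).glueData two_ne).inl ((mapsSecond G₁ G₂).lift₁ b) :=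
  (mapsSecond G₁ G₂).glueMap_ι₁ two_ne W' b

omit [T2Space PBD] [IsManifold (𝓡∂ (n + 2)) ∞ PBD] [CompactSpace A] [CompactSpace B] [CompactSpace C]
  [T2Space A] [IsManifold (𝓡∂ (n + 2)) ∞ A] [IsManifold (𝓡∂ (n + 2)) ∞ B] [T2Space C] [IsManifold (𝓡∂ (n + 2)) ∞ C] [IsManifold (𝓡∂ (n + 2)) ∞ D] in
/-- `e'` on the `D`-part: `ιD d ↦ inr (jD d)`. [folklore] -/
theorem eBD_ι₂ (d : ↥(puncture G₂.kB)) :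
    eBD G₁ G₂ W' (W'.ι₂ d) = ((pairData G₁ G₂).glueData two_ne).inr ((mapsSecond G₁ G₂).lift₂ d) :=
  (mapsSecond G₁ G₂).glueMap_ι₂ two_ne W' d

/-- **The two pieces `A ♮ C`, `B ♮ D` of `X # S` meet exactly along `∂A # ∂C`** (the heart of
Matveyev's fig. 2): `e p = e' q ↔ p = incl z ∧ q = incl' z` for some `z : ∂A # ∂C`. [cite: Matveyev1996, proof of Theorem part 2, fig. 2 (arXiv p. 3)] -/
theorem eAC_eq_eBD_iff (p : PAC) (q : PBD) :
    eAC G₁ G₂ W p = eBD G₁ G₂ W' q ↔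
      ∃ z, p = (βAC G₁ G₂ W).incl z ∧ q = (βBD G₁ G₂ W').incl z := by
  constructor
  · intro h
    rcases W.exists_eq p with ⟨a, rfl⟩ | ⟨c, rfl⟩ <;> rcases W'.exists_eq q with ⟨b, rfl⟩ | ⟨d, rfl⟩
    · -- `inl (jA a) = inl (jB b)`: `a`, `b` are corresponding boundary points
      rw [eAC_ι₁, eBD_ι₁] at h
      have h' : G₁.jA a.val = G₁.jB b.val := congrArg Subtype.val ((SmoothGlueData.inl_injective _) h)
      obtain ⟨z, hz1, hz2⟩ := (G₁.rel _ _).1 h'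
      have hz0 : z ∈ (sigmaData G₁ G₂).A := by
        rw [mem_puncture, sigmaData_i₁]
        rintro rfl
        exact a.2 (by rw [mem_singleton_iff, G₁.kA_zero]; exact hz1)
      refine ⟨(sigmaGlue G₁ G₂).inl ⟨z, hz0⟩, ?_, ?_⟩
      · rw [βAC_incl_inl]; congr 1; exact Subtype.ext hz1
      · rw [βBD_incl_inl]; congr 1; exact Subtype.ext hz2
    · -- `inl (jA a) = inr (jD d)`: an equatorial point
      rw [eAC_ι₁, eBD_ι₂, ConnectedSumData.inl_eq_inr_iff_connectedSumRel] at h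
      obtain ⟨u, t, hu, ht, ha, hd⟩ := h
      simp only [PieceMaps.lift₁_val, PieceMaps.lift₂_val, mapsFirst_j₁, mapsSecond_j₂,
        pairData_i₁, pairData_i₂] at ha hd
      have h0 : u 0 = 0 := le_antisymm
        (nonpos_of_i_smul_eq_jB hu (by linarith [ht.2]) (by linarith [ht.1]) hd.symm)
        (nonneg_of_i_smul_eq_jA hu ht.1 ht.2.le ha.symm)
      obtain ⟨z, w, hzw, hz, hw⟩ := seam_point G₁ G₂ hu h0 ht
      refine ⟨(sigmaGlue G₁ G₂).inl z, ?_, ?_⟩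
      · rw [βAC_incl_inl]; congr 1; apply Subtype.ext
        exact G₁.jA_injective (ha.trans hz)
      · rw [hzw, βBD_incl_inr]; congr 1; apply Subtype.ext
        apply G₂.jB_injective
        rw [hd, hw]
        exact (G₂.rel _ _).2 ⟨w.val, rfl, rfl⟩
    · -- `inr (jC c) = inl (jB b)`: an equatorial point
      rw [eAC_ι₂, eBD_ι₁, eq_comm, ConnectedSumData.inl_eq_inr_iff_connectedSumRel] at h
      obtain ⟨u, t, hu, ht, hb, hc⟩ := h
      simp only [PieceMaps.lift₁_val, PieceMaps.lift₂_val, mapsFirst_j₂, mapsSecond_j₁,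
        pairData_i₁, pairData_i₂] at hb hc
      have h0 : u 0 = 0 := le_antisymm
        (nonpos_of_i_smul_eq_jB hu ht.1 ht.2.le hb.symm)
        (nonneg_of_i_smul_eq_jA hu (by linarith [ht.2]) (by linarith [ht.1]) hc.symm)
      obtain ⟨z, w, hzw, hz, hw⟩ := seam_point G₁ G₂ hu h0 ht
      refine ⟨(sigmaGlue G₁ G₂).inl z, ?_, ?_⟩
      · rw [hzw, βAC_incl_inr]; congr 1; apply Subtype.ext
        exact G₂.jA_injective (hc.trans hw)
      · rw [βBD_incl_inl]; congr 1; apply Subtype.ext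
        apply G₁.jB_injective
        rw [hb, hz]
        exact (G₁.rel _ _).2 ⟨z.val, rfl, rfl⟩
    · -- `inr (jC c) = inr (jD d)`
      rw [eAC_ι₂, eBD_ι₂] at h
      have h' : G₂.jA c.val = G₂.jB d.val := congrArg Subtype.val ((SmoothGlueData.inr_injective _) h)
      obtain ⟨w, hw1, hw2⟩ := (G₂.rel _ _).1 h'
      have hw0 : w ∈ (sigmaData G₁ G₂).B := by
        rw [mem_puncture, sigmaData_i₂]
        rintro rfl
        exact c.2 (by rw [mem_singleton_iff, G₂.kA_zero]; exact hw1)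
      refine ⟨(sigmaGlue G₁ G₂).inr ⟨w, hw0⟩, ?_, ?_⟩
      · rw [βAC_incl_inr]; congr 1; exact Subtype.ext hw1
      · rw [βBD_incl_inr]; congr 1; exact Subtype.ext hw2
  · rintro ⟨x, rfl, rfl⟩
    rcases (sigmaGlue G₁ G₂).exists_inl_or_inr x with ⟨z, rfl⟩ | ⟨w, rfl⟩
    · rw [βAC_incl_inl, βBD_incl_inl, eAC_ι₁, eBD_ι₁]
      congr 1
      apply Subtype.ext
      simp only [PieceMaps.lift₁_val, mapsFirst_j₁, mapsSecond_j₁]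
      exact (G₁.rel _ _).2 ⟨z.val, rfl, rfl⟩
    · rw [βAC_incl_inr, βBD_incl_inr, eAC_ι₂, eBD_ι₂]
      congr 1
      apply Subtype.ext
      simp only [PieceMaps.lift₂_val, mapsFirst_j₂, mapsSecond_j₂]
      exact (G₂.rel _ _).2 ⟨w.val, rfl, rfl⟩

omit [T2Space PAC] [IsManifold (𝓡∂ (n + 2)) ∞ PAC] [T2Space PBD] [IsManifold (𝓡∂ (n + 2)) ∞ PBD]
  [IsManifold (𝓡∂ (n + 2)) ∞ A] [IsManifold (𝓡∂ (n + 2)) ∞ B] [IsManifold (𝓡∂ (n + 2)) ∞ C] [IsManifold (𝓡∂ (n + 2)) ∞ D] in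
/-- **The two pieces cover `X # S`.** [cite: Matveyev1996, proof of Theorem part 2, fig. 2 (arXiv p. 3)] -/
theorem range_eAC_union_range_eBD : range (eAC G₁ G₂ W) ∪ range (eBD G₁ G₂ W') = univ := by
  refine eq_univ_of_forall fun y => ?_
  rcases ((pairData G₁ G₂).glueData two_ne).exists_inl_or_inr y with ⟨x, rfl⟩ | ⟨s, rfl⟩
  · have hx : x.val ≠ G₁.i 0 := by rw [← pairData_i₁ G₁ G₂]; exact x.2
    rcases G₁.exists_eq_of_ne_i_zero hx with ⟨a, ha, hax⟩ | ⟨b, hb, hbx⟩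
    · refine Or.inl ⟨W.ι₁ ⟨a, ha⟩, ?_⟩
      rw [eAC_ι₁]; congr 1; exact Subtype.ext hax
    · refine Or.inr ⟨W'.ι₁ ⟨b, hb⟩, ?_⟩
      rw [eBD_ι₁]; congr 1; exact Subtype.ext hbx
  · have hs : s.val ≠ G₂.i 0 := by rw [← pairData_i₂ G₁ G₂]; exact s.2
    rcases G₂.exists_eq_of_ne_i_zero hs with ⟨c, hc, hcs⟩ | ⟨d, hd, hds⟩
    · refine Or.inl ⟨W.ι₂ ⟨c, hc⟩, ?_⟩
      rw [eAC_ι₂]; congr 1; exact Subtype.ext hcs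
    · refine Or.inr ⟨W'.ι₂ ⟨d, hd⟩, ?_⟩
      rw [eBD_ι₂]; congr 1; exact Subtype.ext hds

variable [CompactSpace PAC] [CompactSpace PBD]

/-- **`X # S = (A ♮ C) ∪_{∂A # ∂C} (B ♮ D)`** for seam-adapted witnesses. [cite: Matveyev1996, proof of Theorem part 2, fig. 2 (arXiv p. 3)] -/
theorem isBoundaryGluing_glued :
    IsBoundaryGluing (βAC G₁ G₂ W) (βBD G₁ G₂ W')
      (Diffeomorph.refl (𝓡 (n + 1)) (βAC G₁ G₂ W).carrier ∞) (𝓡 (n + 2))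
      ((pairData G₁ G₂).glueData two_ne).Glued := by
  refine ⟨eAC G₁ G₂ W, eBD G₁ G₂ W', (mapsFirst G₁ G₂).isSmoothEmbedding_glueMap two_ne W,
    (mapsSecond G₁ G₂).isSmoothEmbedding_glueMap two_ne W', range_eAC_union_range_eBD G₁ G₂ W W',
    fun p q => ?_⟩
  rw [eAC_eq_eBD_iff]
  simp

variable [CompactSpace X] [CompactSpace S]

include G₁ G₂ W W' in
/-- **Matveyev's fig. 2 for seam-adapted witnesses**: the connected sum `Q = X # S` along the
straddling discs is a gluing of `A ♮ C` and `B ♮ D` along `∂A # ∂C`. [cite: Matveyev1996, proof of Theorem part 2, fig. 2 (arXiv p. 3)] -/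
theorem exists_isConnectedSum_isBoundaryGluing :
    ∃ (Q : Type (max u v)) (_ : TopologicalSpace Q) (_ : T2Space Q) (_ : SecondCountableTopology Q)
      (_ : ChartedSpace (𝔼 (n + 2)) Q) (_ : IsManifold (𝓡 (n + 2)) ∞ Q)
      (β : BoundaryData (𝓡∂ (n + 2)) PAC (𝓡 (n + 1)))
      (β' : BoundaryData (𝓡∂ (n + 2)) PBD (𝓡 (n + 1)))
      (θ : β.carrier ≃ₘ⟮𝓡 (n + 1), 𝓡 (n + 1)⟯ β'.carrier),
      IsConnectedSum (𝓡 (n + 2)) (𝓡 (n + 2)) (𝓡 (n + 2)) X S Q ∧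
      IsBoundaryGluing β β' θ (𝓡 (n + 2)) Q :=
  ⟨((pairData G₁ G₂).glueData two_ne).Glued, inferInstance, inferInstance, inferInstance,
    inferInstance, inferInstance, βAC G₁ G₂ W, βBD G₁ G₂ W', Diffeomorph.refl _ _ _,
    (pairData G₁ G₂).isConnectedSum_glued two_ne, isBoundaryGluing_glued G₁ G₂ W W'⟩

end SeamSide

end Assembly

/-! ### §10 The splitting rung from seam-adapted witnesses -/

section Main

/-- **Matveyev's fig. 2 from seam adaptation**: the named fact
`Literature.Topology.FourManifolds.exists_isConnectedSum_isBoundaryGluing_of_halfDiscs` (`CorkDecompositionSplitting.lean`: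
a connected sum `(A ∪_φ B) # (C ∪_χ D)` taken on the seams is `(A ♮ C) ∪_{∂A # ∂C} (B ♮ D)`)
follows from the existence of seam-adapted gluing witnesses (`Literature.Topology.FourManifolds.exists_seamAdaptedWitnesses`,
the compatibility of collars). The connected sum is formed along the discs straddling the seams
provided by the adapted witnesses; `A ♮ C` and `B ♮ D` embed by `ιA a ↦ jA a`, `ιC c ↦ jC c`
(resp. `jB`, `jD`), and they meet along `∂A # ∂C`, the connected sum of the boundaries along the
flat faces of the half-discs, embedded as `∂(A ♮ C)` by `incl_A # incl_C` and as `∂(B ♮ D)` by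
`(incl_B ∘ φ) # (incl_D ∘ χ)` (so that the identification `θ` is the identity of `∂A # ∂C`).
[cite: Matveyev1996, proof of Theorem part 2, fig. 2 (arXiv p. 3)] -/
theorem exists_isConnectedSum_isBoundaryGluing_of_halfDiscs_of_seamAdapted
    (h : exists_seamAdaptedWitnesses.{u, u}) (h₀ : exists_seamAdaptedWitnesses.{u, 0}) :
    exists_isConnectedSum_isBoundaryGluing_of_halfDiscs.{u, 0} := by
  intro n A B C D PAC PBD X S _ _ _ _ _ _ _ _ _ _ _ _ _ _ _ _ _ _ _ _ _ _ _ _ _ _ _ _ _ _ _ _ _ _ _ _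
    _ _ _ _ _ _ _ _ bA bB bC bD φ χ kA kB kC kD fA fC hX hS hkA hkAo hkB hkBo hkC hkCo hkD hkDo
    hfa hfb hfc hfd hPAC hPBD
  obtain ⟨jA, jB, iX, hjA, hjB, hcovX, hrelX, hiX, hiXo, hiA, hiB⟩ :=
    h n A B X bA bB φ kA kB fA hX hkA hkAo hkB hkBo hfa hfb
  obtain ⟨jC, jD, iS, hjC, hjD, hcovS, hrelS, hiS, hiSo, hiC, hiD⟩ :=
    h₀ n C D S bC bD χ kC kD fC hS hkC hkCo hkD hkDo hfc hfd
  let G₁ : SeamSide n A B X :=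
    ⟨bA, bB, φ, kA, kB, fA, jA, jB, iX, hkA, hkAo, hkB, hkBo, hfa, hfb, hjA, hjB, hcovX, hrelX,
      hiX, hiXo, hiA, hiB⟩
  let G₂ : SeamSide n C D S :=
    ⟨bC, bD, χ, kC, kD, fC, jC, jD, iS, hkC, hkCo, hkD, hkDo, hfc, hfd, hjC, hjD, hcovS, hrelS,
      hiS, hiSo, hiC, hiD⟩
  let W : HalfGluing G₁.kA G₂.kA PAC := Classical.choice (HalfGluing.nonempty_of_isOpenGluing hPAC)
  let W' : HalfGluing G₁.kB G₂.kB PBD :=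
    Classical.choice (HalfGluing.nonempty_of_isOpenGluing hPBD)
  haveI : CompactSpace PAC :=
    compactSpace_of_isOpenGluing_boundaryConnectedSumRel_holds (n + 2) A C PAC kA kC hkA hkAo
      hkC hkCo hPAC
  haveI : CompactSpace PBD :=
    compactSpace_of_isOpenGluing_boundaryConnectedSumRel_holds (n + 2) B D PBD kB kD hkB hkBo
      hkD hkDo hPBD
  haveI : CompactSpace X := hX.compactSpace
  haveI : CompactSpace S := hS.compactSpace
  exact SeamSide.exists_isConnectedSum_isBoundaryGluing G₁ G₂ W W'

/-- **The cork decomposition theorem from Matveyev's part 1 + "Fact" and seam adaptation.** With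
this file the residual named facts under `Literature.Topology.FourManifolds.corkDecomposition` (`CorkTwist.lean`) are
`Literature.Topology.FourManifolds.Matveyev1996_partOne_and_fact` (Matveyev's Theorem part 1 and the Kirby-calculus "Fact" of its
proof: 5-dimensional h-cobordism theory) and `Literature.Topology.FourManifolds.exists_seamAdaptedWitnesses` (compatibility of
collars, Hirsch Ch. 8). [cite: Matveyev1996, Theorem] -/
theorem corkDecomposition_of_partOne_fact_seamAdapted (hB : Matveyev1996_partOne_and_fact.{u})
    (h : exists_seamAdaptedWitnesses.{u, u}) (h₀ : exists_seamAdaptedWitnesses.{u, 0}) :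
    corkDecomposition.{u} :=
  corkDecomposition_of_facts hB (exists_isConnectedSum_isBoundaryGluing_of_halfDiscs_of_seamAdapted h h₀)

end Main

end Literature.Topology.FourManifolds

end
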